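/-
Copyright: lit-balaban Phase-2 proof seat p27 (gen 38).  Statement-level skeleton of a published paper; no proof claims beyond what the
kernel checks below.
-/
import Literature.MathematicalPhysics.QuantumFieldTheory.BalabanImbrieJaffe1984to88.BIJ88LocDeriv231RegionOfInputsLipschitz
import Literature.MathematicalPhysics.QuantumFieldTheory.BalabanImbrieJaffe1984to88.BIJ88LocDerivHolder230SmallFieldTorus

/-!
# `BalabanImbrieJaffe1984to88.BIJ88LocDerivHolder231RegionOfInputs` — T. Bałaban, J. Imbrie, A. Jaffe, *Effective action and cluster
properties of the abelian Higgs model*, Commun. Math. Phys. **114** (1988) 257–315 [BalabanImbrieJaffe1988], Sect. 2 p. 263 [PDF 7],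
(2.27)–(2.29), (2.31) and the sentence after (2.33): **THE HÖLDER MEMBER OF ORDER `1 + θ` OF (2.31) FOR A GENERAL REGION `Ω ⊇ Ω₀`, THE
PRINTED CUBES AND WEIGHTS OF RECORD, A SMOOTH CUT-OFF, AN ARBITRARY `U(1)` FIELD `u`, TRANSPORTED ALONG p30's SHORTEST STAIRCASE, FROM
THE SIX [6]-INPUTS AS HYPOTHESES** — print: *"Bounds analogous to (2.30), (2.31) hold for covariant derivatives and Hölder derivatives of
G_{k,loc}(u) of order less than two … for (2.31) we assume smoothness throughout the subset Ω ⊂ T_η"*.  This is the member of top order of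
(2.31) — [6] (1.9) *"with the additional factor (1.12)"* for `ψ = G_{k,loc}(u)f − G_k(Ω,u)f` — in HYPOTHESIS FORM: r18 gen 25's eight-term
split (`BIJ88LocDerivHolder231RegularRegion` §4, there at the (2.23)-regular background with r01's regular inputs and the transport `holA`)
rewritten for an ARBITRARY `U(1)` field with the six [6]-members it consumes as binders and p30's staircase transport `stairHol` (p29 gen
29's bond-by-bond telescoping `norm_stairHol_mul_sub_le_of_near`), so that the small-plaquette members of p27/p30/p34 (this seat's
`closeHolder112_*`, p30's `close112_*`/`holder19_smallField`, p34's region members, through p29's packagings) instantiate it BY NAME — the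
one cell of r18's p. 263 coverage matrix (C2S14-CLOSURE §6, column H1θ at small `u`) that was OPEN.  The companion
`BIJ88LocDerivHolder231SmallPlaquetteTorus` (filed next) is the hypothesis-free instance `Ω = T_η` at small plaquette fields.

statement-level skeleton of published theorems with citation tags; proofs where landed; nothing here is a claim about the Yang–Mills mass gap

PDF held: `paper:balaban1988-cmp114-bij-abelian-higgs-effective-action` (journal page = PDF page + 256); p. 263 [PDF 7] re-read this session
on the render `run/shared/lean/pub/lit-balaban/lit-balaban-p31/renders/original-p007-x2.png`; [6] = [Balaban1983RegularityDecay] Theorem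
p. 573 (1.9)–(1.12) (text layer of `paper:balaban1983-cmp89-regularity-decay` p. 3: *"|(D^η_{A,μ}G_k(Ω,A)f)(x) − U(A(Γ_{x,x′}))(D^η_{A,μ}
G_k(Ω,A)f)(x′)| ≦ c₀|x − x′|^α exp(−δ₀dist({x,x′}, supp f))‖f‖_∞ (1.9) … Γ_{x,x′} a shortest contour … If Ω ⊂ Ω₀, then for δG_k(Ω,Ω₀,A) … we
have the inequalities (1.5) and (1.6) … with the additional factor exp(−δ₀dist(supp f, Ω^c) − δ₀dist({x,x′},Ω^c)) (1.12)"*).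

CITATION HEADER (lean-in-tree rule).  Part of the lit-balaban TYPED SKELETON (HOME `run/shared/lean/pub/lit-balaban/`), PHASE-2 proof seat
p27 gen 38 (unit `lit-balaban-p27-g38`; TAKING #1 line HOME/STATUS.md 2026-08-23T09:15:21Z, free-target protocol G.5-34(d); window closed
09:37Z — p29 g30 «NO OBJECTION — it is yours» 09:16:28Z (his HANDOFF (b) had listed the item as r18's), r18 g25 «NO OBJECTION — WELCOME»
09:17:44Z (C2S14-CLOSURE v1.17b marks the cell TAKEN by p27 g38); FILE 1a `BIJ88LocDeriv231RegionOfInputsLipschitz` p359923 ACCEPTED).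
Rows of `HOME/lit-balaban-r18/ROWS-C2.md` served (LOCATED, HYPOTHESIS-FORM member; cells only, heads unchanged): **C2.Claim@263** *"Bounds
analogous to (2.30), (2.31) … of order less than two"* and **C2.Eq2.31** (head p02's `BIJ88OpClose231Proof`); r15's **C1.Eq7.3.1-7.3.2** by
located consequence only.  Kind: theorems only (no definition, no `Prop`-valued fact; four private kernels).  USED BY NAME, nothing restated:
this seat's FILE 1a `BIJ88LocDeriv231RegionOfInputsLipschitz.deriv231_region_of_inputs_of_lipschitz` (far pairs), p29 g26–30
`BIJ88LocWeights227Torus` (`cubeFam`, `lamFam`, `labels`, `activeLabels`, `rowHyp_i`, `mem_activeLabels_of_ne_zero_of_deep`,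
`card_subtype_activeLabels_le`, `cubeFam_fits`, `cubeOf_subset`, `sum_abs_lamT_le_one`, `mem_and_abs_sub_le_of_T_le`), r18
`BIJ88Close231WholeTorusFlatCwt` (`rowHyp_ii_torus`, `lt_T_of_not_mem`), p29 g27 `BIJ88LocDeriv231FlatTorus` (`covD_gLocT_sub_apply`), p29 g28
`BIJ88LocDerivHolder230FlatTorus` (`abs_weight_shift_sub_le_of_hull`, `abs_weight_bondDiff_sub_le_of_hull`), p29 g29
`BIJ88LocDerivHolder230SmallFieldTorus` (`norm_stairHol_mul_sub_le_of_near`, `stairHol_self`), `BIJ88LocDeriv230ZetaPiFlatTorus`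
(`norm_rowSource_sub_le_of_lipschitz`, the `ζ^Π` facts), `BIJ88LocDeriv230FlatTorus` (`T_shift_le_one`, `abs_T_shift_sub_le`), r18 g25
`BIJ88LocDerivHolder231RegularTorus` v1.2 (`norm_tail_le'`, `norm_tailDiff_le'`, `T_gt_of_tail_ne_zero'`, `T_gt_of_tailDiff_ne_zero'`,
`abs_zeta_shift_sub_le_of_hull`, `abs_zeta_bondDiff_sub_le_of_hull`), p30's `stairHol` / `norm_stairHol` (`BIJ85ScalarPropagatorHolderDecay`),
`BIJ88NeumannPropagatorFlatClose231` (`norm_rowSource_le`, `rowSource_ne_zero`, `abs_lam_le_one`), p31's `gBox` / `gLocT` / `cubeT` /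
`boxCoord` / `cubePt_boxCoord`, p38's metric `B5Ineq137Torus.T` (`B3Bound323ZeroTorus.T_eq_supDist`), r18's `BIJ88Sect3Statements.covD` /
`cfg`, r18's `zetaPi` / `secondDiffConst` (`BIJ88HkLocHolderTorus`), `Literature.Analysis.Calculus.exists_abs_deriv_and_deriv_deriv_smoothTransition_le`.

THE PRINTED TEXT (p. 263, verbatim, print order).  *"|(G_{k,loc}(u)f − G_k(Ω,u)f)(x)| ≦ e^{−cr(e_k)}e^{−c dist(suppt f,x)}‖f‖_∞, (2.31) for
dist(x, Ω^c) ≧ O(r(e_k)). [Each G_k(□_α,u) is close to G_k(Ω,u) for the relevant x₁, x₂, therefore the convex combination and G_{k,loc} are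
close also.] We assume that u is smooth in the □_α's entering the sum in (2.27); for (2.31) we assume smoothness throughout the subset Ω ⊂ T_η.
… Bounds analogous to (2.30), (2.31) hold for covariant derivatives and Hölder derivatives of G_{k,loc}(u) of order less than two."* [v-land docfix: an earlier header continued this quotation with «As in [6, 7] we need control over u in order to obtain these
estimates» — NOT a printed sentence (p. 263 text layer `p0007.txt` L27–28 continues «We use G_{k,loc} to define a localized quadratic form for
scalar fields, (2.34)»); it was a READING of the role of (2.32) (*"We assume that u is smooth in the □_α's entering the sum in (2.27); for (2.31)
we assume smoothness throughout the subset Ω ⊂ T_η"*, p. 263 L19–21); observation p34 g22 2026-08-23T16:09Z; declarations untouched]; (2.29): *"ζ″(x₁, x₂) = 0 for |x₁ − x₂| ≧ 2r(e_k), = 1 for |x₁ − x₂| ≦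
r(e_k)"*, *"ζ_k(x₁, x₂) is a smooth function of x₁ − x₂"*.

THE MATHEMATICS (ours — r18's eight-term split in p29's staircase mechanics; declared).  Fix the bonds `⟨x₁,x₁'⟩`, `⟨x₂,x₂'⟩` (`x_i' =
x_i + e_μ`), `τ = U(Γ_{x₁,x₂})` (p30's `stairHol`), `ψ = G_{k,loc}(u)f − G_k(Ω,u)f`.  NEAR PAIRS `|x₁ − x₂|_T ≤ L^k`: by p29 g27's bond identity
(2.32) (`covD_gLocT_sub_apply`, row hypothesis (i) `Σ_αλ_α = 1` where `ζ″ ≠ 0` at the four end points),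
`D_uψ(x,μ) = Σ_α[D_u(V_αg′_α)] + Σ_α ε⁻¹[V_α(Δg_α)](x) + D_u(G₀q′)(x,μ) + ε⁻¹(G₀Δq)(x)` with `V_α = G_k(□_α,u) − G_k(Ω,u)`, `G₀ = G_k(Ω,u)`,
the row source `g′_α = ζ″(x',·)λ_α(x',·)f`, its bond difference `Δg_α`, the tails `q′ = (ζ″(x',·) − 1)f`, `Δq = (ζ″(x',·) − ζ″(x,·))f`; hence
`τ·D_uψ(x₂,μ) − D_uψ(x₁,μ)` is the sum of EIGHT terms: (A) `τ·D_u(V_αg′_{α,x₂'})(x₂) − D_u(V_αg′_{α,x₂'})(x₁)` ← (H5) per cube active at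
`x₂'` (both rows in `□_α`, `ρ`-deep, because an active cube at a point `(R₀+R)`-deep in the chart contains the `R`-ball about it, read against
the whole torus — r18's `rowHyp_ii_torus` — and `R ≥ ρ + L^k + 3`); (B) `D_u(V_α(g′_{α,x₂'} − g′_{α,x₁'}))(x₁)` ← (H1), the source being
`≤ Λ₁(d+1)|x₁ − x₂|_T·F` (Lipschitz along the chart hull); (C) `ε⁻¹[τ·(V_αΔg_{α,x₂})(x₂) − (V_αΔg_{α,x₂})(x₁)]` ← telescoped bond by bond along
the staircase (whose sites stay within `|x₁ − x₂|_T` of both ends, hence in `□_α`, `ρ`-deep) with (H1) per bond on a source `≤ Λ₁F`; (D)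
`ε⁻¹(V_α(Δg_{α,x₂} − Δg_{α,x₁}))(x₁)` ← (H2) on a second difference `≤ Λ₂(d+1)|x₁ − x₂|_T·F` of the row weights, `ε⁻¹(L^kε)² = (L^kε)L^k`;
(A″) `τ·D_u(G₀q′_{x₂'})(x₂) − D_u(G₀q′_{x₂'})(x₁)` ← (H6); (B″) `D_u(G₀(q′_{x₂'} − q′_{x₁'}))(x₁)` ← (H3); (C″) the staircase telescoping of
`ε⁻¹G₀Δq_{x₂}` with (H3) per bond; (D″) `ε⁻¹(G₀(Δq_{x₂} − Δq_{x₁}))(x₁)` ← (H4).  Every cube input is fed the depth `D_b = R − 2 − L^k` (the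
evaluation rows are within `L^k + 2` of the active end point), `D_f = R` and the support distance `max(D − L^k, 0)`; every tail input the
support distance `max(D − L^k, R₁ − 2 − L^k, 0)` (the tails vanish where `ζ″ = 1`, i.e. within `R₁` of the output point); whence the
displayed slack `e^{3δ₀}` against the rates `e^{−(δ₀/2)D/L^k}`, `e^{−δ₀(2R−1)/L^k}`, `e^{−(δ₀/2)(R₁−1)/L^k}`.  The weight `(L^k/|x₁ − x₂|_T)^θ`
is spent as `w·|x₁ − x₂|_T ≤ L^k` on (B)(C)(D)(B″)(C″)(D″) and absorbed as `L^kΛ₁ ≤ Λ₀·(1 + L^k((R₀−R₁)⁻¹+s⁻¹))`, `(L^k)²Λ₂ ≤ Λ₀₂·(1 + …)²`,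
`L^kK₁/(R₀−R₁) ≤ K₁(1 + …)`, `(L^k)²K₂/(R₀−R₁)² ≤ K₂(1 + …)²`; `≤ m, 2m, 2m, 4m` active labels.  FAR PAIRS: `w ≤ 1`, two covariant-derivative
members (FILE 1a), `|τ| = 1`.  Coincident points: `stairHol u x x = 1`.

WHAT IS PROVED (theorems only; 0 `sorry`; standard axioms).
* §1 **`derivHolder231_region_of_inputs_of_smooth`** — for `0 ≤ c₀`, `0 ≤ θ < 1`, `K₁, K₂ ≥ 0`: `∃ C > 0` (on `d, c₀, θ, K₁, K₂`) such that
  for every torus of the series (`P.d = d+1`), every `a`, `1 ≤ k ≤ K`, every `U(1)` field `u`, every finite region `Ω`, all `δ₀ > 0`, `ρ ≥ 0`,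
  GIVEN (H1)–(H4) VERBATIM as in p29's `deriv231_region_of_inputs` / FILE 1a ((1.11)–(1.12) `D_u` and value closeness `G_k(□,u)` vs
  `G_k(Ω,u)` for the fitting no-wrap cubes `□ ⊆ Ω` at their `ρ`-deep rows; (1.10) `D_u` and value members of `G_k(Ω,u)` at the `ρ`-deep rows
  of `Ω`), (H5) the (1.11)–(1.12) HÖLDER-of-`D_u` closeness member for the fitting cubes `□ ⊆ Ω` at pairs of distinct `ρ`-deep rows (binder
  shape of this seat's `closeHolder112_smallPlaquette_region`: exponent `θ`, transport `stairHol`, `D_u` of the difference), (H6) the (1.9)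
  Hölder-of-`D_u` member of `G_k(Ω,u)` at pairs of distinct `ρ`-deep rows of `Ω` (shape of p30's `holder19_smallField`), all at `(c₀, δ₀)`;
  for the reference box `Ω₀ = c·L^k + Π_i[0, L^kM₀_i) ⊆ Ω` shorter than the torus with torus gap `≥ R`, `s ≥ 1`, `R ≥ ρ + L^k + 3`,
  `0 ≤ R₁ < R₀`, `W ≥ 2s/3 + R₀/2 + R`, EVERY real `ζ″` with `|ζ″| ≤ 1`, `= 0` beyond `R₀`, `= 1` within `R₁`, first lattice differences in the
  output point `≤ K₁/(R₀−R₁)`, mixed second ones `≤ K₂/(R₀−R₁)²`, every `μ`, all `x₁, x₂` with the four bond ends in `Ω₀` at chart depth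
  `≥ R₀ + R`, every `f` (`‖f‖_∞ ≤ F`) supported at sup-torus distance `≥ D ≥ 0` from `x₁` and `x₂`:
  `(L^k/|x₁ − x₂|_T)^θ·‖τ·(D_uψ)(x₂,μ) − (D_uψ)(x₁,μ)‖ ≤ (L^kε)·C·e^{3δ₀}·(1 + L^k((R₀−R₁)⁻¹ + s⁻¹))²·[m·e^{−δ₀(2R−1)/L^k} + e^{−(δ₀/2)(R₁−1)/L^k}]·e^{−(δ₀/2)D/L^k}·F`,
  `m = (⌊(L^k − 1 + R₀)/s⌋ + 3)^{d+1}` (`D_uψ` written as the difference of the two covariant derivatives).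
* §2 **`derivHolder231_region_of_inputs_zetaPi`** — §1 at r18's smooth product cut-off `ζ″ = zetaPi R₁ R₀ 0` (`1 ≤ R₁ < R₀ ≤ (|T^{(0)}| − 3)/2`;
  `K₁ = C_σ`, `K₂ = C_σ² + C_σ`), hypothesis-free in the cut-off.
HONEST SCOPE / DIVERGENCE.  (i) HYPOTHESIS FORM: (H1)–(H6) are binders; providers of record at small plaquette fields — p29's
`inputs_smallPlaquette_region` (ρ = L^k; p30 g29 p358281 + p34) for (H1)–(H4), this seat's `closeHolder112_smallPlaquette_region` (p358926,
ρ = 17L^k) for (H5), p30's `holder19_smallField` (torus) / this seat's `holder19_smallPlaquette_cube_uniform` (cubes) for (H6) — NO (1.9)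
Hölder member of `G_k(Ω,u)` for a general `k`-block union at small fields is in the tree, so the hypothesis-free instance (companion file) is
`Ω = T_η`; at the regular background r18's `BIJ88LocDerivHolder231RegularRegion` is the hypothesis-free theorem of record (transport `holA`).
(ii) DEEP BONDS ONLY (chart depth `≥ R₀ + R`, `R ≥ ρ + L^k + 3`; print's (2.31) is stated *"for dist(x, Ω^c) ≧ O(r(e_k))"*); the region
enters only through `G_k(Ω,u)` and the inputs, the data live in `Ω₀ ⊆ Ω`.  (iii) Transport = p30's explicit shortest staircase `stairHol`
(one of [6]'s shortest contours), not an arbitrary shortest contour; near/far threshold `|x₁ − x₂|_T ≤ L^k`.  (iv) SMOOTH cut-offs only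
(second differences needed for (D), (D″)); §2 is the member for `ζ^Π`; p13's Lipschitz `cutoff R₁ R₀ |·|_T` is NOT covered (as in p29's /
r18's order-(1+θ) files).  (v) Constants explicit up to the inputs' `(c₀, δ₀)` (`C = κ_c + κ_t + 2C_far + 1`, `κ_c = c₀(1 + 4(d+1)(Λ₀ + Λ₀₂))`,
`κ_t = c₀(2 + 2(d+1)K₁ + (d+1)K₂)`, `Λ₀ = max(K₁, 3π(d+1)/2)`, `Λ₀₂ = K₂ + 4π² + 3π(d+1)K₁`), not optimized; the slack `e^{3δ₀}` displayed
(an instance with fixed `δ₀` absorbs it).  `set_option maxHeartbeats 1600000` on §1, `800000` on §2 (elaboration budget; long statements).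
DIVERGENCE OF METHOD as in every file of this lane: print defers to [6]'s random-walk expansion; here the eight-term algebra is kernel-checked
and the [6]-members enter as hypotheses.  Imports: FILE 1a `BIJ88LocDeriv231RegionOfInputsLipschitz` (→ p29 `BIJ88Loc231RegionOfInputs`, r18
`BIJ88LocDerivHolder231RegularTorus`), p29 g29 `BIJ88LocDerivHolder230SmallFieldTorus`.  Literature + Mathlib only.  Unit `lit-balaban-p27`
(literature-prover-lit-balaban-p27-g38-0), HOME `run/shared/lean/pub/lit-balaban/`, 2026-08-23.  NOT summit progress, continuum or Clay.
-/

open scoped BigOperators Matrix ComplexConjugate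
open Finset Matrix

namespace Literature.MathematicalPhysics.QuantumFieldTheory.BalabanImbrieJaffe1984to88.BIJ88LocDerivHolder231RegionOfInputs

open Literature.MathematicalPhysics.QuantumFieldTheory.Balaban1983to89
open LatticeFieldCalculus (supDist)
open BIJ88Sect3Statements (U1 toC cfg covD norm_toC)
open BIJ85BlockAveragesTorus BIJ85BlockAveragesTorusK
open BIJ88NeumannPropagator227Torus (gBox)
open BIJ88DeltaLoc234Torus (gLocT)
open BIJ88NeumannPropagatorFlatDecayCube
open BIJ88LocWeights227Torus
open BIJ88Close231WholeTorusFlatCwt (rowHyp_ii_torus lt_T_of_not_mem)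
open BIJ88NeumannPropagatorFlatClose231 (norm_rowSource_le rowSource_ne_zero abs_lam_le_one)
open BIJ88LocDeriv230FlatTorus (T_shift_le_one abs_T_shift_sub_le)
open BIJ88LocDeriv230ZetaPiFlatTorus (norm_rowSource_sub_le_of_lipschitz)
open BIJ88LocDerivHolder230FlatTorus (abs_weight_shift_sub_le_of_hull abs_weight_bondDiff_sub_le_of_hull)
open BIJ88LocDeriv231FlatTorus (covD_gLocT_sub_apply)
open BIJ88LocDerivHolder231RegularTorus (norm_tail_le' norm_tailDiff_le' T_gt_of_tail_ne_zero' T_gt_of_tailDiff_ne_zero'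
  abs_zeta_shift_sub_le_of_hull abs_zeta_bondDiff_sub_le_of_hull)
open BIJ88LocDerivHolder230SmallFieldTorus (norm_stairHol_mul_sub_le_of_near stairHol_self)
open BIJ85ScalarPropagatorHolderDecay (stairHol norm_stairHol)
open B3Bound323ZeroTorus (T_eq_supDist)
open B4Reflection242 (boxDom mem_boxDom)

noncomputable section

variable {d : ℕ} {P : Params}

/-- kernel: a deeper chart margin implies a shallower one. [folklore] -/
private theorem depth_mono (hPd : P.d = d + 1) {n : ℕ} {c M0 : Fin (d + 1) → ℕ} {D D' : ℝ} (hDD : D ≤ D') {x : Balaban1983to89.Site P 0}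
    (hdeep : ∀ i, D' ≤ (boxCoord hPd n c x i : ℝ) ∧ (boxCoord hPd n c x i : ℝ) + D' ≤ (n * M0 i : ℕ) - 1) :
    ∀ i, D ≤ (boxCoord hPd n c x i : ℝ) ∧ (boxCoord hPd n c x i : ℝ) + D ≤ (n * M0 i : ℕ) - 1 :=
  fun i => ⟨hDD.trans (hdeep i).1, by linarith [(hdeep i).2]⟩

/-- kernel: the covariant derivative is additive in the function. [cite: BalabanImbrieJaffe1988, (3.3) p.265] -/
private theorem covD_sub (c' : ℝ) (u : PBond P 0 → ℂ) (φ ψ : Balaban1983to89.Site P 0 → ℂ) (b : PBond P 0) :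
    covD c' u (φ - ψ) b = covD c' u φ b - covD c' u ψ b := by
  simp only [covD, Pi.sub_apply]; ring

/-- kernel: `D_u` of the zero function vanishes. [cite: BalabanImbrieJaffe1988, (3.3) p.265] -/
private theorem covD_zero (c' : ℝ) (u : PBond P 0 → ℂ) (b : PBond P 0) : covD c' u (0 : Balaban1983to89.Site P 0 → ℂ) b = 0 := by
  simp only [covD, Pi.zero_apply, mul_zero, sub_zero]

/-- kernel: for `1 ≤ t` and `θ ≤ 1`, `t^θ ≤ t`. [folklore] -/
private theorem rpow_le_self_of_one_le {t θ : ℝ} (ht : 1 ≤ t) (hθ : θ ≤ 1) : t ^ θ ≤ t := by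
  have h := Real.rpow_le_rpow_of_exponent_le ht hθ
  rwa [Real.rpow_one] at h

/-! ## §1 The Hölder member of order `1 + θ` of (2.31) for a general region `Ω ⊇ Ω₀`, hypothesis form (eight-term split) -/

section DerivHolder

set_option maxHeartbeats 1600000 in
/-- **THE HÖLDER MEMBER OF ORDER `1 + θ` (`0 ≤ θ < 1`) OF (2.31) FOR A GENERAL REGION `Ω ⊇ Ω₀`, THE PRINTED CUBES AND WEIGHTS, A SMOOTH
CUT-OFF, AN ARBITRARY `U(1)` FIELD, TRANSPORTED ALONG p30's SHORTEST STAIRCASE, FROM THE SIX [6]-INPUTS AS HYPOTHESES** (p. 263: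
*"Bounds analogous to (2.30), (2.31) hold for covariant derivatives and Hölder derivatives of G_{k,loc}(u) of order less than two … for
(2.31) we assume smoothness throughout the subset Ω ⊂ T_η"* — the member of top order of (2.31), i.e. [6] (1.9) *"with the additional
factor (1.12)"* for `ψ = G_{k,loc}(u)f − G_k(Ω,u)f`).  For `0 ≤ c₀`, `0 ≤ θ < 1`, moduli `K₁, K₂ ≥ 0`: `∃ C > 0` (on `d, c₀, θ, K₁, K₂`)
such that on every torus of the series (`P.d = d+1`), every `a`, `1 ≤ k ≤ K`, every `U(1)` field `u`, every finite region `Ω`, all rates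
`δ₀ > 0` and depths `ρ ≥ 0`, GIVEN (H1)–(H4) exactly as in p29's `deriv231_region_of_inputs` / §1 of
`BIJ88LocDeriv231RegionOfInputsLipschitz` ((1.11)–(1.12) `D_u`/value closeness `G_k(□,u)` vs `G_k(Ω,u)` for the fitting cubes `□ ⊆ Ω` at
their `ρ`-deep rows; (1.10) `D_u`/value members of `G_k(Ω,u)` at the `ρ`-deep rows of `Ω`), (H5) the (1.11)–(1.12) HÖLDER-of-`D_u` closeness
for the fitting cubes `□ ⊆ Ω` at pairs of distinct `ρ`-deep rows (binder shape of p27's `closeHolder112_smallPlaquette_region`, exponent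
`θ`, transport `stairHol`), (H6) the (1.9) Hölder-of-`D_u` member of `G_k(Ω,u)` at pairs of distinct `ρ`-deep rows of `Ω` (shape of p30's
`holder19_smallField`), all at `(c₀, δ₀)`; for the reference box `Ω₀ ⊆ Ω`, `s ≥ 1`, `R ≥ ρ + L^k + 3`, `0 ≤ R₁ < R₀`, `W ≥ 2s/3 + R₀/2 + R`,
torus gap `≥ R`, EVERY real cut-off `ζ″` with `|ζ″| ≤ 1`, `= 0` beyond `R₀`, `= 1` within `R₁`, first lattice differences in the output
point `≤ K₁/(R₀−R₁)` and mixed second ones `≤ K₂/(R₀−R₁)²`, every direction `μ`, all bonds `⟨x₁, x₁+e_μ⟩`, `⟨x₂, x₂+e_μ⟩` with their four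
end points in `Ω₀` at chart depth `≥ R₀ + R`, every `f` (`‖f‖_∞ ≤ F`) supported at sup-torus distance `≥ D ≥ 0` from `x₁` and `x₂`:
`(L^k/|x₁ − x₂|_T)^θ·‖U(Γ_{x₁,x₂})(D_uψ)(x₂,μ) − (D_uψ)(x₁,μ)‖ ≤`
`(L^kε)·C·e^{3δ₀}·(1 + L^k((R₀−R₁)⁻¹ + s⁻¹))²·[m·e^{−δ₀(2R−1)/L^k} + e^{−(δ₀/2)(R₁−1)/L^k}]·e^{−(δ₀/2)D/L^k}·F`,
`m = (⌊(L^k − 1 + R₀)/s⌋ + 3)^{d+1}`, `U(Γ)` = p30's `stairHol u x₁ x₂` (`D_uψ` written as the difference of the two covariant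
derivatives).  MECHANISM = r18 gen 25's eight-term split (`BIJ88LocDerivHolder231RegularRegion` §4) in p29 gen 29's staircase mechanics
(`BIJ88LocDerivHolder230SmallFieldTorus`): NEAR PAIRS `|x₁ − x₂|_T ≤ L^k` — p29 g27's bond identity `covD_gLocT_sub_apply` at both bonds;
cube part (A) ← (H5) per cube active at `x₂ + e_μ` on its fixed row source, (B) ← (H1) at `⟨x₁, x₁+e_μ⟩` on the difference of the row
sources of `x₂ + e_μ`, `x₁ + e_μ` (p29 g28's `abs_weight_shift_sub_le_of_hull`), (C) ← the transported difference of the values of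
`(G_k(□_α,u) − G_k(Ω,u))` on the bond-difference source of `x₂` TELESCOPED BOND BY BOND ALONG THE STAIRCASE (p29 g29's
`norm_stairHol_mul_sub_le_of_near`) with (H1) per bond, (D) ← (H2) on the second difference of the row weights
(`abs_weight_bondDiff_sub_le_of_hull`); tail part (`G_k(Ω,u)` on `(ζ″ − 1)f`, `Δζ″·f`, `Δ²ζ″·f`, which live at distance `> R₁ − 1`):
(A″) ← (H6), (B″) ← (H3) at `x₁` (r18's `abs_zeta_shift_sub_le_of_hull`), (C″) ← the staircase telescoping with (H3) per bond, (D″) ← (H4)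
(r18's `abs_zeta_bondDiff_sub_le_of_hull`); every cube input is fed the depths `D_b = R − 2 − L^k`, `D_f = R` and the support distance
`max(D − L^k, 0)`, every tail input the support distance `max(D − L^k, R₁ − 2 − L^k, 0)` — whence the displayed slack `e^{3δ₀}`; FAR PAIRS:
two covariant-derivative members (§1 of `BIJ88LocDeriv231RegionOfInputsLipschitz`), `|U(Γ)| = 1`.
[cite: BalabanImbrieJaffe1988, (2.31) p.263] [cite: Balaban1983RegularityDecay, Theorem p.573 (1.9), (1.11)–(1.12)] -/
theorem derivHolder231_region_of_inputs_of_smooth (d : ℕ) {c₀ : ℝ} (hc₀ : 0 ≤ c₀) {θ : ℝ} (hθ0 : 0 ≤ θ) (hθ1 : θ < 1)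
    {K₁ K₂ : ℝ} (hK₁ : 0 ≤ K₁) (hK₂ : 0 ≤ K₂) :
    ∃ C : ℝ, 0 < C ∧ ∀ (P : Params) (hPd : P.d = d + 1) (a : ℝ) (k : ℕ), 1 ≤ k → k ≤ P.K →
      ∀ (U : GaugeField P 0 U1) (Ω : Finset (Balaban1983to89.Site P 0)) (δ₀ ρ : ℝ), 0 < δ₀ → 0 ≤ ρ →
      -- (H1) the (1.11)–(1.12) covariant-derivative closeness member for the fitting no-wrap cubes `□ ⊆ Ω`
      (∀ (c' M' : Fin (d + 1) → ℕ), (∀ i, 1 ≤ M' i) → (∀ i, c' i * P.L ^ k + P.L ^ k * M' i ≤ P.sitesPerDir 0) →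
          (∀ i, P.L ^ k * M' i < P.sitesPerDir 0) → (cubeT hPd (P.L ^ k) c' fun i => P.L ^ k * M' i) ⊆ Ω →
        ∀ (x : Balaban1983to89.Site P 0) (μ : Fin P.d), x ∈ (cubeT hPd (P.L ^ k) c' fun i => P.L ^ k * M' i) →
          x.shift μ ∈ (cubeT hPd (P.L ^ k) c' fun i => P.L ^ k * M' i) →
          (∀ w, w ∉ (cubeT hPd (P.L ^ k) c' fun i => P.L ^ k * M' i) → ρ ≤ B5Ineq137Torus.T P 0 x w) →
        ∀ (g : Balaban1983to89.Site P 0 → ℂ) (F D Db Df : ℝ), (∀ y, ‖g y‖ ≤ F) →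
          (∀ y, y ∉ (cubeT hPd (P.L ^ k) c' fun i => P.L ^ k * M' i) → g y = 0) →
          0 ≤ D → (∀ y, g y ≠ 0 → D ≤ B5Ineq137Torus.T P 0 x y) →
          0 ≤ Db → (∀ w, w ∉ (cubeT hPd (P.L ^ k) c' fun i => P.L ^ k * M' i) → Db ≤ B5Ineq137Torus.T P 0 x w) →
          0 ≤ Df → (∀ y, g y ≠ 0 → ∀ w, w ∉ (cubeT hPd (P.L ^ k) c' fun i => P.L ^ k * M' i) → Df ≤ B5Ineq137Torus.T P 0 y w) →
          ‖covD P.eps⁻¹ (cfg U) (gBox (B1RG242Torus.α P a k * (P.L : ℝ) ^ (k * P.d)) P.eps⁻¹ U k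
                  (cubeT hPd (P.L ^ k) c' fun i => P.L ^ k * M' i) *ᵥ g) ⟨x, μ⟩ -
              covD P.eps⁻¹ (cfg U) (gBox (B1RG242Torus.α P a k * (P.L : ℝ) ^ (k * P.d)) P.eps⁻¹ U k Ω *ᵥ g) ⟨x, μ⟩‖ ≤
            P.spacing k * (c₀ * Real.exp (-(δ₀ * (((P.L : ℝ) ^ k)⁻¹ * D))) * Real.exp (-(δ₀ * (((P.L : ℝ) ^ k)⁻¹ * (Db + Df)))) * F)) →
      -- (H2) the (1.11)–(1.12) value closeness member for the same cubes and rows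
      (∀ (c' M' : Fin (d + 1) → ℕ), (∀ i, 1 ≤ M' i) → (∀ i, c' i * P.L ^ k + P.L ^ k * M' i ≤ P.sitesPerDir 0) →
          (∀ i, P.L ^ k * M' i < P.sitesPerDir 0) → (cubeT hPd (P.L ^ k) c' fun i => P.L ^ k * M' i) ⊆ Ω →
        ∀ (x : Balaban1983to89.Site P 0), x ∈ (cubeT hPd (P.L ^ k) c' fun i => P.L ^ k * M' i) →
          (∀ w, w ∉ (cubeT hPd (P.L ^ k) c' fun i => P.L ^ k * M' i) → ρ ≤ B5Ineq137Torus.T P 0 x w) →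
        ∀ (g : Balaban1983to89.Site P 0 → ℂ) (F D Db Df : ℝ), (∀ y, ‖g y‖ ≤ F) →
          (∀ y, y ∉ (cubeT hPd (P.L ^ k) c' fun i => P.L ^ k * M' i) → g y = 0) →
          0 ≤ D → (∀ y, g y ≠ 0 → D ≤ B5Ineq137Torus.T P 0 x y) →
          0 ≤ Db → (∀ w, w ∉ (cubeT hPd (P.L ^ k) c' fun i => P.L ^ k * M' i) → Db ≤ B5Ineq137Torus.T P 0 x w) →
          0 ≤ Df → (∀ y, g y ≠ 0 → ∀ w, w ∉ (cubeT hPd (P.L ^ k) c' fun i => P.L ^ k * M' i) → Df ≤ B5Ineq137Torus.T P 0 y w) →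
          ‖(gBox (B1RG242Torus.α P a k * (P.L : ℝ) ^ (k * P.d)) P.eps⁻¹ U k (cubeT hPd (P.L ^ k) c' fun i => P.L ^ k * M' i) *ᵥ g) x -
              (gBox (B1RG242Torus.α P a k * (P.L : ℝ) ^ (k * P.d)) P.eps⁻¹ U k Ω *ᵥ g) x‖ ≤
            P.spacing k ^ 2 * (c₀ * Real.exp (-(δ₀ * (((P.L : ℝ) ^ k)⁻¹ * D))) * Real.exp (-(δ₀ * (((P.L : ℝ) ^ k)⁻¹ * (Db + Df)))) * F)) →
      -- (H3) the (1.10) covariant-derivative member of `G_k(Ω,u)` at the `ρ`-deep rows of `Ω`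
      (∀ (x : Balaban1983to89.Site P 0), x ∈ Ω → (∀ w, w ∉ Ω → ρ ≤ B5Ineq137Torus.T P 0 x w) →
        ∀ (μ : Fin P.d) (g : Balaban1983to89.Site P 0 → ℂ) (F D : ℝ), (∀ y, ‖g y‖ ≤ F) → 0 ≤ D →
          (∀ y, g y ≠ 0 → D ≤ B5Ineq137Torus.T P 0 x y) →
          ‖covD P.eps⁻¹ (cfg U) (gBox (B1RG242Torus.α P a k * (P.L : ℝ) ^ (k * P.d)) P.eps⁻¹ U k Ω *ᵥ g) ⟨x, μ⟩‖ ≤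
            P.spacing k * (c₀ * Real.exp (-(δ₀ * (((P.L : ℝ) ^ k)⁻¹ * D))) * F)) →
      -- (H4) the (1.10) value member of `G_k(Ω,u)` at the `ρ`-deep rows of `Ω`
      (∀ (x : Balaban1983to89.Site P 0), x ∈ Ω → (∀ w, w ∉ Ω → ρ ≤ B5Ineq137Torus.T P 0 x w) →
        ∀ (g : Balaban1983to89.Site P 0 → ℂ) (F D : ℝ), (∀ y, ‖g y‖ ≤ F) → 0 ≤ D →
          (∀ y, g y ≠ 0 → D ≤ B5Ineq137Torus.T P 0 x y) →
          ‖(gBox (B1RG242Torus.α P a k * (P.L : ℝ) ^ (k * P.d)) P.eps⁻¹ U k Ω *ᵥ g) x‖ ≤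
            P.spacing k ^ 2 * (c₀ * Real.exp (-(δ₀ * (((P.L : ℝ) ^ k)⁻¹ * D))) * F)) →
      -- (H5) the (1.11)–(1.12) Hölder-of-`D_u` closeness member for the fitting no-wrap cubes `□ ⊆ Ω` at pairs of distinct `ρ`-deep rows
      (∀ (c' M' : Fin (d + 1) → ℕ), (∀ i, 1 ≤ M' i) → (∀ i, c' i * P.L ^ k + P.L ^ k * M' i ≤ P.sitesPerDir 0) →
          (∀ i, P.L ^ k * M' i < P.sitesPerDir 0) → (cubeT hPd (P.L ^ k) c' fun i => P.L ^ k * M' i) ⊆ Ω →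
        ∀ (x₁ x₂ : Balaban1983to89.Site P 0) (μ : Fin P.d), x₁ ≠ x₂ → x₁ ∈ (cubeT hPd (P.L ^ k) c' fun i => P.L ^ k * M' i) → x₂ ∈ (cubeT hPd (P.L ^ k) c' fun i => P.L ^ k * M' i) →
          (∀ w, w ∉ (cubeT hPd (P.L ^ k) c' fun i => P.L ^ k * M' i) → ρ ≤ B5Ineq137Torus.T P 0 x₁ w) →
          (∀ w, w ∉ (cubeT hPd (P.L ^ k) c' fun i => P.L ^ k * M' i) → ρ ≤ B5Ineq137Torus.T P 0 x₂ w) →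
        ∀ (g : Balaban1983to89.Site P 0 → ℂ) (F D Db Df : ℝ), (∀ y, ‖g y‖ ≤ F) →
          (∀ y, y ∉ (cubeT hPd (P.L ^ k) c' fun i => P.L ^ k * M' i) → g y = 0) →
          0 ≤ D → (∀ y, g y ≠ 0 → D ≤ B5Ineq137Torus.T P 0 x₁ y) → (∀ y, g y ≠ 0 → D ≤ B5Ineq137Torus.T P 0 x₂ y) →
          0 ≤ Db → (∀ w, w ∉ (cubeT hPd (P.L ^ k) c' fun i => P.L ^ k * M' i) → Db ≤ B5Ineq137Torus.T P 0 x₁ w) →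
          (∀ w, w ∉ (cubeT hPd (P.L ^ k) c' fun i => P.L ^ k * M' i) → Db ≤ B5Ineq137Torus.T P 0 x₂ w) →
          0 ≤ Df → (∀ y, g y ≠ 0 → ∀ w, w ∉ (cubeT hPd (P.L ^ k) c' fun i => P.L ^ k * M' i) → Df ≤ B5Ineq137Torus.T P 0 y w) →
          ((P.L : ℝ) ^ k / B5Ineq137Torus.T P 0 x₁ x₂) ^ θ *
              ‖stairHol U x₁ x₂ *
                  covD P.eps⁻¹ (cfg U) (gBox (B1RG242Torus.α P a k * (P.L : ℝ) ^ (k * P.d)) P.eps⁻¹ U k (cubeT hPd (P.L ^ k) c' fun i => P.L ^ k * M' i) *ᵥ g -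
                    gBox (B1RG242Torus.α P a k * (P.L : ℝ) ^ (k * P.d)) P.eps⁻¹ U k Ω *ᵥ g) ⟨x₂, μ⟩ -
                covD P.eps⁻¹ (cfg U) (gBox (B1RG242Torus.α P a k * (P.L : ℝ) ^ (k * P.d)) P.eps⁻¹ U k (cubeT hPd (P.L ^ k) c' fun i => P.L ^ k * M' i) *ᵥ g -
                    gBox (B1RG242Torus.α P a k * (P.L : ℝ) ^ (k * P.d)) P.eps⁻¹ U k Ω *ᵥ g) ⟨x₁, μ⟩‖ ≤
            P.spacing k * (c₀ * Real.exp (-(δ₀ * (((P.L : ℝ) ^ k)⁻¹ * D))) * Real.exp (-(δ₀ * (((P.L : ℝ) ^ k)⁻¹ * (Db + Df)))) * F)) →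
      -- (H6) the (1.9) Hölder-of-`D_u` member of `G_k(Ω,u)` at pairs of distinct `ρ`-deep rows of `Ω`
      (∀ (x₁ x₂ : Balaban1983to89.Site P 0) (μ : Fin P.d), x₁ ≠ x₂ → x₁ ∈ Ω → x₂ ∈ Ω →
          (∀ w, w ∉ Ω → ρ ≤ B5Ineq137Torus.T P 0 x₁ w) → (∀ w, w ∉ Ω → ρ ≤ B5Ineq137Torus.T P 0 x₂ w) →
        ∀ (g : Balaban1983to89.Site P 0 → ℂ) (F D : ℝ), (∀ y, ‖g y‖ ≤ F) → 0 ≤ D →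
          (∀ y, g y ≠ 0 → D ≤ B5Ineq137Torus.T P 0 x₁ y) → (∀ y, g y ≠ 0 → D ≤ B5Ineq137Torus.T P 0 x₂ y) →
          ((P.L : ℝ) ^ k / B5Ineq137Torus.T P 0 x₁ x₂) ^ θ *
              ‖stairHol U x₁ x₂ * covD P.eps⁻¹ (cfg U) (gBox (B1RG242Torus.α P a k * (P.L : ℝ) ^ (k * P.d)) P.eps⁻¹ U k Ω *ᵥ g) ⟨x₂, μ⟩ -
                covD P.eps⁻¹ (cfg U) (gBox (B1RG242Torus.α P a k * (P.L : ℝ) ^ (k * P.d)) P.eps⁻¹ U k Ω *ᵥ g) ⟨x₁, μ⟩‖ ≤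
            P.spacing k * (c₀ * Real.exp (-(δ₀ * (((P.L : ℝ) ^ k)⁻¹ * D))) * F)) →
      ∀ (c M0 : Fin (d + 1) → ℕ), (∀ i, 1 ≤ M0 i) →
        (∀ i, c i * P.L ^ k + P.L ^ k * M0 i ≤ P.sitesPerDir 0) → (∀ i, P.L ^ k * M0 i < P.sitesPerDir 0) →
        (cubeT hPd (P.L ^ k) c fun i => P.L ^ k * M0 i) ⊆ Ω →
      ∀ (s W : ℕ), 1 ≤ s → ∀ (R R₀ R₁ : ℝ), ρ + (P.L : ℝ) ^ k + 3 ≤ R → 0 ≤ R₁ → R₁ < R₀ → 2 * (s : ℝ) / 3 + R₀ / 2 + R ≤ W →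
        (∀ i, ((P.L ^ k * M0 i : ℕ) : ℝ) + R ≤ P.sitesPerDir 0) →
      ∀ (ζ : Balaban1983to89.Site P 0 → Balaban1983to89.Site P 0 → ℝ), (∀ x y, |ζ x y| ≤ 1) →
        (∀ x y, R₀ ≤ B5Ineq137Torus.T P 0 x y → ζ x y = 0) → (∀ x y, B5Ineq137Torus.T P 0 x y ≤ R₁ → ζ x y = 1) →
        (∀ (x y : Balaban1983to89.Site P 0) (ν : Fin P.d), |ζ (x.shift ν) y - ζ x y| ≤ K₁ / (R₀ - R₁)) →
        (∀ (x y : Balaban1983to89.Site P 0) (κ ν : Fin P.d),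
          |ζ ((x.shift ν).shift κ) y - ζ (x.shift ν) y - ζ (x.shift κ) y + ζ x y| ≤ K₂ / (R₀ - R₁) ^ 2) →
      ∀ (x₁ x₂ : Balaban1983to89.Site P 0) (μ : Fin P.d),
        x₁ ∈ (cubeT hPd (P.L ^ k) c fun i => P.L ^ k * M0 i) →
        (∀ i, R₀ + R ≤ (boxCoord hPd (P.L ^ k) c x₁ i : ℝ) ∧ (boxCoord hPd (P.L ^ k) c x₁ i : ℝ) + (R₀ + R) ≤ (P.L ^ k * M0 i : ℕ) - 1) →
        x₁.shift μ ∈ (cubeT hPd (P.L ^ k) c fun i => P.L ^ k * M0 i) →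
        (∀ i, R₀ + R ≤ (boxCoord hPd (P.L ^ k) c (x₁.shift μ) i : ℝ) ∧
          (boxCoord hPd (P.L ^ k) c (x₁.shift μ) i : ℝ) + (R₀ + R) ≤ (P.L ^ k * M0 i : ℕ) - 1) →
        x₂ ∈ (cubeT hPd (P.L ^ k) c fun i => P.L ^ k * M0 i) →
        (∀ i, R₀ + R ≤ (boxCoord hPd (P.L ^ k) c x₂ i : ℝ) ∧ (boxCoord hPd (P.L ^ k) c x₂ i : ℝ) + (R₀ + R) ≤ (P.L ^ k * M0 i : ℕ) - 1) →
        x₂.shift μ ∈ (cubeT hPd (P.L ^ k) c fun i => P.L ^ k * M0 i) →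
        (∀ i, R₀ + R ≤ (boxCoord hPd (P.L ^ k) c (x₂.shift μ) i : ℝ) ∧
          (boxCoord hPd (P.L ^ k) c (x₂.shift μ) i : ℝ) + (R₀ + R) ≤ (P.L ^ k * M0 i : ℕ) - 1) →
      ∀ (f : Balaban1983to89.Site P 0 → ℂ) (F D : ℝ), (∀ y, ‖f y‖ ≤ F) → 0 ≤ D →
        (∀ y, f y ≠ 0 → D ≤ B5Ineq137Torus.T P 0 x₁ y) → (∀ y, f y ≠ 0 → D ≤ B5Ineq137Torus.T P 0 x₂ y) →
        ((P.L : ℝ) ^ k / B5Ineq137Torus.T P 0 x₁ x₂) ^ θ *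
          ‖stairHol U x₁ x₂ *
              (covD P.eps⁻¹ (cfg U)
                  (gLocT (B1RG242Torus.α P a k * (P.L : ℝ) ^ (k * P.d)) P.eps⁻¹ U k
                    (cubeFam hPd (P.L ^ k) c M0 s W) (lamFam hPd (P.L ^ k) c M0 s) ζ *ᵥ f) ⟨x₂, μ⟩ -
                covD P.eps⁻¹ (cfg U) (gBox (B1RG242Torus.α P a k * (P.L : ℝ) ^ (k * P.d)) P.eps⁻¹ U k Ω *ᵥ f) ⟨x₂, μ⟩) -
            (covD P.eps⁻¹ (cfg U)
                (gLocT (B1RG242Torus.α P a k * (P.L : ℝ) ^ (k * P.d)) P.eps⁻¹ U k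
                  (cubeFam hPd (P.L ^ k) c M0 s W) (lamFam hPd (P.L ^ k) c M0 s) ζ *ᵥ f) ⟨x₁, μ⟩ -
              covD P.eps⁻¹ (cfg U) (gBox (B1RG242Torus.α P a k * (P.L : ℝ) ^ (k * P.d)) P.eps⁻¹ U k Ω *ᵥ f) ⟨x₁, μ⟩)‖ ≤
          P.spacing k * (C * Real.exp (3 * δ₀) * (1 + (P.L : ℝ) ^ k * ((R₀ - R₁)⁻¹ + (s : ℝ)⁻¹)) ^ 2 *
            ((⌊(((P.L : ℝ) ^ k) - 1 + R₀) / s⌋₊ + 3) ^ (d + 1) * Real.exp (-(δ₀ * (((P.L : ℝ) ^ k)⁻¹ * (2 * R - 1)))) +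
              Real.exp (-(δ₀ / 2 * (((P.L : ℝ) ^ k)⁻¹ * (R₁ - 1))))) *
            Real.exp (-(δ₀ / 2 * (((P.L : ℝ) ^ k)⁻¹ * D))) * F) := by
  obtain ⟨Cf, hCf0, Hfar⟩ := BIJ88LocDeriv231RegionOfInputsLipschitz.deriv231_region_of_inputs_of_lipschitz d hc₀ hK₁
  -- the constants
  set Λ₀ : ℝ := max K₁ (3 * Real.pi * (d + 1 : ℕ) / 2) with hΛ₀def
  have hΛ₀0 : 0 ≤ Λ₀ := hK₁.trans (le_max_left _ _)
  set Λ₀₂ : ℝ := K₂ + 4 * Real.pi ^ 2 + 3 * Real.pi * (d + 1 : ℕ) * K₁ with hΛ₀₂def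
  have hΛ₀₂0 : 0 ≤ Λ₀₂ := by rw [hΛ₀₂def]; positivity
  set κc : ℝ := c₀ * (1 + 4 * ((d : ℝ) + 1) * Λ₀ + 4 * ((d : ℝ) + 1) * Λ₀₂) with hκcdef
  set κt : ℝ := c₀ * (2 + 2 * ((d : ℝ) + 1) * K₁ + ((d : ℝ) + 1) * K₂) with hκtdef
  have hκc0 : 0 ≤ κc := by rw [hκcdef]; positivity
  have hκt0 : 0 ≤ κt := by rw [hκtdef]; positivity
  set C : ℝ := κc + κt + 2 * Cf + 1 with hCdef
  have hC0 : 0 < C := by rw [hCdef]; positivity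
  refine ⟨C, hC0, ?_⟩
  intro P hPd a k hk1 hkK U Ω δ₀ ρ hδ₀ hρ H1 H2 H3 H4 H5 H6 c M0 hM0 hfit0 hN0 hΩ s W hs R R₀ R₁ hR hR₁ hR10 hW hgap
    ζ hζabs hζ0 hζR₁ hζ1 hζ2 x₁ x₂ μ hx₁ hdeep₁ hx₁e hdeep₁e hx₂ hdeep₂ hx₂e hdeep₂e f F D hF hD hsupp₁ hsupp₂
  -- elementary facts
  have hn : 1 ≤ P.L ^ k := Nat.one_le_pow _ _ P.L_pos
  have hk : 0 + k ≤ P.m + P.K := by omega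
  have hLpos : (0 : ℝ) < P.L := P.cast_L_pos
  have hLk : (0 : ℝ) < (P.L : ℝ) ^ k := pow_pos hLpos _
  have hLk1 : (1 : ℝ) ≤ (P.L : ℝ) ^ k := by exact_mod_cast hn
  have hLkinv : 0 < ((P.L : ℝ) ^ k)⁻¹ := inv_pos.mpr hLk
  have hLLk : ((P.L : ℝ) ^ k)⁻¹ * (P.L : ℝ) ^ k = 1 := inv_mul_cancel₀ hLk.ne'
  have hinv1 : ((P.L : ℝ) ^ k)⁻¹ ≤ 1 := inv_le_one_of_one_le₀ hLk1
  have hRρ : ρ + 1 < R := by linarith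
  have hR1 : 1 < R := by linarith
  have hR0 : 0 ≤ R := by linarith
  have hR₀ : 0 ≤ R₀ := hR₁.trans hR10.le
  have hs0 : 0 < s := hs
  have hsr : (0 : ℝ) < s := by exact_mod_cast hs0
  have hgap' : 0 < R₀ - R₁ := sub_pos.2 hR10
  have hF0 : 0 ≤ F := (norm_nonneg _).trans (hF x₁)
  have hsp0 : 0 < P.spacing k := P.spacing_pos k
  have heps : 0 < P.eps := P.eps_pos
  have hK₁' : 0 ≤ K₁ / (R₀ - R₁) := div_nonneg hK₁ hgap'.le
  have hK₂' : 0 ≤ K₂ / (R₀ - R₁) ^ 2 := by positivity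
  have hPdR : (P.d : ℝ) = (d : ℝ) + 1 := by rw [hPd]; push_cast; ring
  -- the shallower depths `R₀` (row hypothesis (i), label multiplicities) and `ρ` (the region inputs)
  have hdeep₁0 := depth_mono hPd (show R₀ ≤ R₀ + R by linarith) hdeep₁
  have hdeep₁e0 := depth_mono hPd (show R₀ ≤ R₀ + R by linarith) hdeep₁e
  have hdeep₂0 := depth_mono hPd (show R₀ ≤ R₀ + R by linarith) hdeep₂
  have hdeep₂e0 := depth_mono hPd (show R₀ ≤ R₀ + R by linarith) hdeep₂e
  -- abbreviations
  set Ω₀ : Finset (Balaban1983to89.Site P 0) := cubeT hPd (P.L ^ k) c fun i => P.L ^ k * M0 i with hΩ₀def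
  set A : ℝ := B1RG242Torus.α P a k * (P.L : ℝ) ^ (k * P.d) with hAdef
  set x₁' := x₁.shift μ with hx₁'def
  set x₂' := x₂.shift μ with hx₂'def
  set T12 : ℝ := B5Ineq137Torus.T P 0 x₁ x₂ with hT12def
  have hT0 : 0 ≤ T12 := B5Ineq137Torus.T_nonneg P 0 x₁ x₂
  have hT12N : T12 = (supDist x₁ x₂ : ℝ) := T_eq_supDist P x₁ x₂
  set m : ℝ := ((⌊(((P.L : ℝ) ^ k) - 1 + R₀) / s⌋₊ : ℝ) + 3) ^ (d + 1) with hmdef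
  have hm0 : 0 ≤ m := by rw [hmdef]; positivity
  set uv : ℝ := (R₀ - R₁)⁻¹ + (s : ℝ)⁻¹ with huvdef
  have huv0 : 0 ≤ uv := by rw [huvdef]; positivity
  have huv1 : (R₀ - R₁)⁻¹ ≤ uv := by rw [huvdef]; exact le_add_of_nonneg_right (by positivity)
  set br : ℝ := 1 + (P.L : ℝ) ^ k * uv with hbrdef
  have hbr1 : 1 ≤ br := by rw [hbrdef]; exact le_add_of_nonneg_right (by positivity)
  have hbr0 : 0 ≤ br := zero_le_one.trans hbr1
  have hbr2 : br ≤ br ^ 2 := by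
    calc br = 1 * br := (one_mul _).symm
      _ ≤ br * br := mul_le_mul_of_nonneg_right hbr1 hbr0
      _ = br ^ 2 := (sq br).symm
  have hbr21 : 1 ≤ br ^ 2 := hbr1.trans hbr2
  have hLuv : (P.L : ℝ) ^ k * uv ≤ br := by rw [hbrdef]; exact le_add_of_nonneg_left zero_le_one
  have hLR01 : (P.L : ℝ) ^ k * (R₀ - R₁)⁻¹ ≤ br := (mul_le_mul_of_nonneg_left huv1 hLk.le).trans hLuv
  set E : ℝ := Real.exp (-(δ₀ / 2 * (((P.L : ℝ) ^ k)⁻¹ * D))) with hEdef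
  set E2R : ℝ := Real.exp (-(δ₀ * (((P.L : ℝ) ^ k)⁻¹ * (2 * R - 1)))) with hE2Rdef
  set ER1 : ℝ := Real.exp (-(δ₀ / 2 * (((P.L : ℝ) ^ k)⁻¹ * (R₁ - 1)))) with hER1def
  set eδ : ℝ := Real.exp (3 * δ₀) with heδdef
  have hE0 : 0 < E := Real.exp_pos _
  have hE2R0 : 0 < E2R := Real.exp_pos _
  have hER10 : 0 < ER1 := Real.exp_pos _
  have heδ0 : 0 < eδ := Real.exp_pos _
  have heδ1 : 1 ≤ eδ := by rw [heδdef]; exact Real.one_le_exp (by positivity)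
  set GE : ℝ := eδ * E * E2R with hGEdef
  set TE : ℝ := eδ * E * ER1 with hTEdef
  have hGE0 : 0 < GE := by positivity
  have hTE0 : 0 < TE := by positivity
  -- the target, factorised
  have hRHS : P.spacing k * (C * eδ * br ^ 2 * (m * E2R + ER1) * E * F) =
      P.spacing k * (C * Real.exp (3 * δ₀) * (1 + (P.L : ℝ) ^ k * ((R₀ - R₁)⁻¹ + (s : ℝ)⁻¹)) ^ 2 *
        ((⌊(((P.L : ℝ) ^ k) - 1 + R₀) / s⌋₊ + 3) ^ (d + 1) * Real.exp (-(δ₀ * (((P.L : ℝ) ^ k)⁻¹ * (2 * R - 1)))) +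
          Real.exp (-(δ₀ / 2 * (((P.L : ℝ) ^ k)⁻¹ * (R₁ - 1))))) *
        Real.exp (-(δ₀ / 2 * (((P.L : ℝ) ^ k)⁻¹ * D))) * F) := by
    rw [hmdef, hbrdef, huvdef, hEdef, hE2Rdef, hER1def, heδdef]
  rw [← hRHS]
  have hbody0 : 0 ≤ br ^ 2 * (m * E2R + ER1) * E * F := by positivity
  have hRHS0 : 0 ≤ P.spacing k * (C * eδ * br ^ 2 * (m * E2R + ER1) * E * F) := by positivity
  -- the weight
  set w : ℝ := ((P.L : ℝ) ^ k / T12) ^ θ with hwdef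
  have hw0 : 0 ≤ w := Real.rpow_nonneg (div_nonneg hLk.le hT0) θ
  -- coincident points: the difference vanishes
  by_cases hne : x₂ = x₁
  · rw [hne, stairHol_self, one_mul, sub_self, norm_zero, mul_zero]
    exact hRHS0
  by_cases hnear : (P.L : ℝ) ^ k < T12
  · /- FAR PAIRS: two covariant-derivative members of (2.31) (§1 of `BIJ88LocDeriv231RegionOfInputsLipschitz`), `|U(Γ)| = 1` -/
    have hTpos : 0 < T12 := hLk.trans hnear
    have hw1 : w ≤ 1 := by
      refine Real.rpow_le_one (div_nonneg hLk.le hT0) ?_ hθ0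
      rw [div_le_one hTpos]; exact hnear.le
    have hg₁ := Hfar P hPd a k hk1 hkK U Ω δ₀ ρ hδ₀ hρ H1 H2 H3 H4 c M0 hM0 hfit0 hN0 hΩ s W hs R R₀ R₁ hRρ hR₁ hR10 hW hgap ζ hζabs
      hζ0 hζR₁ hζ1 x₁ μ hx₁ hdeep₁ hx₁e hdeep₁e f F D hF hD hsupp₁
    have hg₂ := Hfar P hPd a k hk1 hkK U Ω δ₀ ρ hδ₀ hρ H1 H2 H3 H4 c M0 hM0 hfit0 hN0 hΩ s W hs R R₀ R₁ hRρ hR₁ hR10 hW hgap ζ hζabs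
      hζ0 hζR₁ hζ1 x₂ μ hx₂ hdeep₂ hx₂e hdeep₂e f F D hF hD hsupp₂
    set X₁ := covD P.eps⁻¹ (cfg U) (gLocT A P.eps⁻¹ U k (cubeFam hPd (P.L ^ k) c M0 s W) (lamFam hPd (P.L ^ k) c M0 s) ζ *ᵥ f) ⟨x₁, μ⟩ -
      covD P.eps⁻¹ (cfg U) (gBox A P.eps⁻¹ U k Ω *ᵥ f) ⟨x₁, μ⟩ with hX₁def
    set X₂ := covD P.eps⁻¹ (cfg U) (gLocT A P.eps⁻¹ U k (cubeFam hPd (P.L ^ k) c M0 s W) (lamFam hPd (P.L ^ k) c M0 s) ζ *ᵥ f) ⟨x₂, μ⟩ -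
      covD P.eps⁻¹ (cfg U) (gBox A P.eps⁻¹ U k Ω *ᵥ f) ⟨x₂, μ⟩ with hX₂def
    have hbrk : m * (1 + (P.L : ℝ) ^ k * ((R₀ - R₁)⁻¹ + (s : ℝ)⁻¹)) * E2R + (1 + (P.L : ℝ) ^ k * (R₀ - R₁)⁻¹) * ER1 ≤
        br * (m * E2R + ER1) := by
      rw [← huvdef, ← hbrdef]
      have h1 : 1 + (P.L : ℝ) ^ k * (R₀ - R₁)⁻¹ ≤ br := by
        rw [hbrdef]; exact add_le_add le_rfl (mul_le_mul_of_nonneg_left huv1 hLk.le)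
      have h2 : (1 + (P.L : ℝ) ^ k * (R₀ - R₁)⁻¹) * ER1 ≤ br * ER1 := mul_le_mul_of_nonneg_right h1 hER10.le
      calc m * br * E2R + (1 + (P.L : ℝ) ^ k * (R₀ - R₁)⁻¹) * ER1 ≤ m * br * E2R + br * ER1 := add_le_add le_rfl h2
        _ = br * (m * E2R + ER1) := by ring
    have hBf : ∀ X : ℝ, X ≤ P.spacing k * (Cf * (m * (1 + (P.L : ℝ) ^ k * ((R₀ - R₁)⁻¹ + (s : ℝ)⁻¹)) * E2R +
        (1 + (P.L : ℝ) ^ k * (R₀ - R₁)⁻¹) * ER1) * E * F) → X ≤ P.spacing k * (Cf * br * (m * E2R + ER1) * E * F) := by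
      intro X hX
      refine hX.trans (mul_le_mul_of_nonneg_left ?_ hsp0.le)
      have := mul_le_mul_of_nonneg_left hbrk hCf0.le
      calc Cf * (m * (1 + (P.L : ℝ) ^ k * ((R₀ - R₁)⁻¹ + (s : ℝ)⁻¹)) * E2R + (1 + (P.L : ℝ) ^ k * (R₀ - R₁)⁻¹) * ER1) * E * F
          ≤ Cf * (br * (m * E2R + ER1)) * E * F := mul_le_mul_of_nonneg_right (mul_le_mul_of_nonneg_right this hE0.le) hF0
        _ = Cf * br * (m * E2R + ER1) * E * F := by ring
    have h1 : ‖X₁‖ ≤ P.spacing k * (Cf * br * (m * E2R + ER1) * E * F) := hBf _ (by rw [hX₁def, hmdef, hE2Rdef, hER1def, hEdef]; exact hg₁)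
    have h2 : ‖X₂‖ ≤ P.spacing k * (Cf * br * (m * E2R + ER1) * E * F) := hBf _ (by rw [hX₂def, hmdef, hE2Rdef, hER1def, hEdef]; exact hg₂)
    have hτ : ‖stairHol U x₁ x₂ * X₂‖ = ‖X₂‖ := by rw [norm_mul, norm_stairHol, one_mul]
    calc w * ‖stairHol U x₁ x₂ * X₂ - X₁‖ ≤ 1 * ‖stairHol U x₁ x₂ * X₂ - X₁‖ := mul_le_mul_of_nonneg_right hw1 (norm_nonneg _)
      _ ≤ ‖stairHol U x₁ x₂ * X₂‖ + ‖X₁‖ := by rw [one_mul]; exact norm_sub_le _ _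
      _ ≤ P.spacing k * (Cf * br * (m * E2R + ER1) * E * F) + P.spacing k * (Cf * br * (m * E2R + ER1) * E * F) := by
          rw [hτ]; exact add_le_add h2 h1
      _ = P.spacing k * ((2 * Cf) * br * (m * E2R + ER1) * E * F) := by ring
      _ ≤ P.spacing k * (C * eδ * br ^ 2 * (m * E2R + ER1) * E * F) := by
          refine mul_le_mul_of_nonneg_left ?_ hsp0.le
          have hc : 2 * Cf ≤ C * eδ := by
            have h3 : 2 * Cf ≤ C := by rw [hCdef]; linarith only [hκc0, hκt0]
            calc 2 * Cf = 2 * Cf * 1 := (mul_one _).symm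
              _ ≤ C * eδ := mul_le_mul h3 heδ1 zero_le_one hC0.le
          have h4 : (2 * Cf) * br ≤ C * eδ * br ^ 2 := mul_le_mul hc hbr2 hbr0 (by positivity)
          have h5 : 0 ≤ (m * E2R + ER1) := by positivity
          calc (2 * Cf) * br * (m * E2R + ER1) * E * F = ((2 * Cf) * br) * ((m * E2R + ER1) * E * F) := by ring
            _ ≤ (C * eδ * br ^ 2) * ((m * E2R + ER1) * E * F) := mul_le_mul_of_nonneg_right h4 (by positivity)
            _ = C * eδ * br ^ 2 * (m * E2R + ER1) * E * F := by ring
  /- NEAR PAIRS -/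
  push Not at hnear
  have hne12 : x₁ ≠ x₂ := fun h => hne h.symm
  -- chart coordinates
  obtain ⟨hz₁, hxz₁⟩ := cubePt_boxCoord hPd hfit0 hx₁
  obtain ⟨hz₂, hxz₂⟩ := cubePt_boxCoord hPd hfit0 hx₂
  set z₁ := boxCoord hPd (P.L ^ k) c x₁ with hz₁def
  set z₂ := boxCoord hPd (P.L ^ k) c x₂ with hz₂def
  have hdeepT : ∀ i, T12 ≤ (z₁ i : ℝ) ∧ (z₁ i : ℝ) + T12 ≤ (P.L ^ k * M0 i : ℕ) - 1 := fun i => by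
    have h1 := hdeep₁ i
    constructor <;> linarith only [h1.1, h1.2, hnear, hR, hρ, hR₀]
  have hclose : ∀ i, ((|z₁ i - z₂ i| : ℤ) : ℝ) ≤ T12 := (mem_and_abs_sub_le_of_T_le hPd hfit0 hdeepT le_rfl).2
  have hroom₁ : ∀ j, z₁ j + 1 < ((P.L ^ k * M0 j : ℕ) : ℤ) := fun j => by
    have h1 : ((z₁ j : ℤ) : ℝ) + 2 ≤ ((P.L ^ k * M0 j : ℕ) : ℝ) := by linarith only [(hdeep₁ j).2, hR1, hR₀]
    have h2 : z₁ j + 2 ≤ ((P.L ^ k * M0 j : ℕ) : ℤ) := by exact_mod_cast h1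
    omega
  have hroom₂ : ∀ j, z₂ j + 1 < ((P.L ^ k * M0 j : ℕ) : ℤ) := fun j => by
    have h1 : ((z₂ j : ℤ) : ℝ) + 2 ≤ ((P.L ^ k * M0 j : ℕ) : ℝ) := by linarith only [(hdeep₂ j).2, hR1, hR₀]
    have h2 : z₂ j + 2 ≤ ((P.L ^ k * M0 j : ℕ) : ℤ) := by exact_mod_cast h1
    omega
  have hl1 : ∑ j, ((|z₂ j - z₁ j| : ℤ) : ℝ) ≤ ((d : ℝ) + 1) * T12 := by
    calc ∑ j, ((|z₂ j - z₁ j| : ℤ) : ℝ) ≤ ∑ _j : Fin (d + 1), T12 :=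
          Finset.sum_le_sum fun j _ => by rw [abs_sub_comm]; exact hclose j
      _ = ((d : ℝ) + 1) * T12 := by rw [Finset.sum_const, Finset.card_univ, Fintype.card_fin, nsmul_eq_mul]; push_cast; ring
  -- the weight against one factor `T12`: `w·T12 ≤ L^k`
  have hwT : w * T12 ≤ (P.L : ℝ) ^ k := by
    rcases hT0.eq_or_lt with hT00 | hTpos
    · rw [← hT00, mul_zero]; exact hLk.le
    · have hq : 1 ≤ (P.L : ℝ) ^ k / T12 := by rw [le_div_iff₀ hTpos, one_mul]; exact hnear
      calc w * T12 ≤ (P.L : ℝ) ^ k / T12 * T12 := mul_le_mul_of_nonneg_right (rpow_le_self_of_one_le hq hθ1.le) hT0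
        _ = (P.L : ℝ) ^ k := div_mul_cancel₀ _ hTpos.ne'
  -- distances between the four end points
  have hT2'2 : B5Ineq137Torus.T P 0 x₂' x₂ ≤ 1 := by rw [B5Ineq137Torus.T_symm]; exact T_shift_le_one x₂ μ
  have hT1'1 : B5Ineq137Torus.T P 0 x₁' x₁ ≤ 1 := by rw [B5Ineq137Torus.T_symm]; exact T_shift_le_one x₁ μ
  have hT21 : B5Ineq137Torus.T P 0 x₂ x₁ = T12 := by rw [B5Ineq137Torus.T_symm]
  have hT2'1 : B5Ineq137Torus.T P 0 x₂' x₁ ≤ 1 + T12 := by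
    have := B5Ineq137Torus.T_triangle P 0 x₂' x₂ x₁; linarith only [this, hT2'2, hT21]
  have hT1'2 : B5Ineq137Torus.T P 0 x₁' x₂ ≤ 1 + T12 := by
    have := B5Ineq137Torus.T_triangle P 0 x₁' x₁ x₂; linarith only [this, hT1'1]
  have hT2'1' : B5Ineq137Torus.T P 0 x₂' x₁' ≤ 2 + T12 := by
    have h1 := B5Ineq137Torus.T_triangle P 0 x₂' x₁ x₁'; have h2 := T_shift_le_one (P := P) x₁ μ; linarith only [h1, h2, hT2'1]
  have hTshift : ∀ (p q : Balaban1983to89.Site P 0) (ν : Fin P.d), B5Ineq137Torus.T P 0 p (q.shift ν) ≤ B5Ineq137Torus.T P 0 p q + 1 := by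
    intro p q ν
    have h1 := abs_le.1 (abs_T_shift_sub_le q p ν)
    rw [B5Ineq137Torus.T_symm P 0 p (q.shift ν), B5Ineq137Torus.T_symm P 0 p q]
    linarith only [h1.2]
  -- the active-label sets of the four end points
  have hmem : ∀ x : Balaban1983to89.Site P 0, x ∈ blockK k (blkIter k x) := fun x => mem_blockK.2 rfl
  set S : Balaban1983to89.Site P 0 → Finset ↥(labels (P.L ^ k) M0 s) := fun p =>
    (activeLabels hPd (P.L ^ k) c s R₀ (blkIter k p)).subtype fun α => α ∈ labels (P.L ^ k) M0 s with hSdef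
  have hcard : ∀ p, ((S p).card : ℝ) ≤ m := fun p => by
    have h1 := card_subtype_activeLabels_le (hPd := hPd) (c := c) (M0 := M0) hn hs0 hR₀ (blkIter k p)
    have e : (((P.L ^ k : ℕ) : ℕ) : ℝ) = (P.L : ℝ) ^ k := by push_cast; rfl
    rw [e] at h1; exact h1
  have hS : ∀ (p : Balaban1983to89.Site P 0),
      (∀ i, R₀ ≤ (boxCoord hPd (P.L ^ k) c p i : ℝ) ∧ (boxCoord hPd (P.L ^ k) c p i : ℝ) + R₀ ≤ (P.L ^ k * M0 i : ℕ) - 1) →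
      ∀ (α : ↥(labels (P.L ^ k) M0 s)) (y : Balaban1983to89.Site P 0), ζ p y * lamFam hPd (P.L ^ k) c M0 s α p y ≠ 0 → α ∈ S p := by
    intro p hdeep α y hne'
    rw [hSdef, Finset.mem_subtype]
    exact mem_activeLabels_of_ne_zero_of_deep hk hs0 hfit0 hζ0 (hmem p) hdeep hne'
  -- geometry of a cube active at one of the four end points, READ AGAINST THE WHOLE TORUS (r18's `rowHyp_ii_torus`)
  have geo : ∀ (p : Balaban1983to89.Site P 0), p ∈ Ω₀ →
      (∀ i, R₀ + R ≤ (boxCoord hPd (P.L ^ k) c p i : ℝ) ∧ (boxCoord hPd (P.L ^ k) c p i : ℝ) + (R₀ + R) ≤ (P.L ^ k * M0 i : ℕ) - 1) →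
      ∀ (α : ↥(labels (P.L ^ k) M0 s)) (y : Balaban1983to89.Site P 0), ζ p y * lamFam hPd (P.L ^ k) c M0 s α p y ≠ 0 →
      p ∈ cubeFam hPd (P.L ^ k) c M0 s W α ∧ y ∈ cubeFam hPd (P.L ^ k) c M0 s W α ∧
        ∀ v, v ∉ cubeFam hPd (P.L ^ k) c M0 s W α → R ≤ B5Ineq137Torus.T P 0 p v ∧ R ≤ B5Ineq137Torus.T P 0 y v :=
    fun p hp hdp α y hy => rowHyp_ii_torus hPd hn hs0 hfit0 hR0 hR₀ hgap hW hζ0 hp hdp α y hy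
  -- … every point within `R` of the active end point lies in the cube
  have nearα : ∀ (p : Balaban1983to89.Site P 0), p ∈ Ω₀ →
      (∀ i, R₀ + R ≤ (boxCoord hPd (P.L ^ k) c p i : ℝ) ∧ (boxCoord hPd (P.L ^ k) c p i : ℝ) + (R₀ + R) ≤ (P.L ^ k * M0 i : ℕ) - 1) →
      ∀ (α : ↥(labels (P.L ^ k) M0 s)), (∃ y, ζ p y * lamFam hPd (P.L ^ k) c M0 s α p y ≠ 0) →
      ∀ q : Balaban1983to89.Site P 0, B5Ineq137Torus.T P 0 p q < R → q ∈ cubeFam hPd (P.L ^ k) c M0 s W α := by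
    intro p hp hdp α ⟨y₀, hy₀⟩ q hq
    by_contra hnot
    have h1 := ((geo p hp hdp α y₀ hy₀).2.2 q hnot).1
    linarith only [h1, hq]
  -- … and every point within `L^k + 2` of it sees `T ∖ □_α` at distance `≥ R − 2 − L^k ≥ ρ + 1`
  set Db : ℝ := R - 2 - (P.L : ℝ) ^ k with hDbdef
  have hDb0 : 0 ≤ Db := by rw [hDbdef]; linarith only [hR, hρ]
  have hDbρ : ρ ≤ Db := by rw [hDbdef]; linarith only [hR]
  have depthα : ∀ (p : Balaban1983to89.Site P 0), p ∈ Ω₀ →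
      (∀ i, R₀ + R ≤ (boxCoord hPd (P.L ^ k) c p i : ℝ) ∧ (boxCoord hPd (P.L ^ k) c p i : ℝ) + (R₀ + R) ≤ (P.L ^ k * M0 i : ℕ) - 1) →
      ∀ (α : ↥(labels (P.L ^ k) M0 s)), (∃ y, ζ p y * lamFam hPd (P.L ^ k) c M0 s α p y ≠ 0) →
      ∀ q : Balaban1983to89.Site P 0, B5Ineq137Torus.T P 0 p q ≤ (P.L : ℝ) ^ k + 2 →
        ∀ v, v ∉ cubeFam hPd (P.L ^ k) c M0 s W α → Db ≤ B5Ineq137Torus.T P 0 q v := by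
    intro p hp hdp α ⟨y₀, hy₀⟩ q hpq v hv
    have h1 := ((geo p hp hdp α y₀ hy₀).2.2 v hv).1
    have h2 := B5Ineq137Torus.T_triangle P 0 p q v
    rw [hDbdef]; linarith only [h1, h2, hpq]
  have depthαρ : ∀ (p : Balaban1983to89.Site P 0), p ∈ Ω₀ →
      (∀ i, R₀ + R ≤ (boxCoord hPd (P.L ^ k) c p i : ℝ) ∧ (boxCoord hPd (P.L ^ k) c p i : ℝ) + (R₀ + R) ≤ (P.L ^ k * M0 i : ℕ) - 1) →
      ∀ (α : ↥(labels (P.L ^ k) M0 s)), (∃ y, ζ p y * lamFam hPd (P.L ^ k) c M0 s α p y ≠ 0) →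
      ∀ q : Balaban1983to89.Site P 0, B5Ineq137Torus.T P 0 p q ≤ (P.L : ℝ) ^ k + 2 →
        ∀ v, v ∉ cubeFam hPd (P.L ^ k) c M0 s W α → ρ ≤ B5Ineq137Torus.T P 0 q v :=
    fun p hp hdp α hex q hpq v hv => hDbρ.trans (depthα p hp hdp α hex q hpq v hv)
  -- the sources active at an end point live in the cube, `R`-deep
  have srcα : ∀ (p : Balaban1983to89.Site P 0), p ∈ Ω₀ →
      (∀ i, R₀ + R ≤ (boxCoord hPd (P.L ^ k) c p i : ℝ) ∧ (boxCoord hPd (P.L ^ k) c p i : ℝ) + (R₀ + R) ≤ (P.L ^ k * M0 i : ℕ) - 1) →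
      ∀ (α : ↥(labels (P.L ^ k) M0 s)) (y : Balaban1983to89.Site P 0), ζ p y * lamFam hPd (P.L ^ k) c M0 s α p y ≠ 0 →
      y ∈ cubeFam hPd (P.L ^ k) c M0 s W α ∧ ∀ v, v ∉ cubeFam hPd (P.L ^ k) c M0 s W α → R ≤ B5Ineq137Torus.T P 0 y v :=
    fun p hp hdp α y hy => ⟨(geo p hp hdp α y hy).2.1, fun v hv => ((geo p hp hdp α y hy).2.2 v hv).2⟩
  -- the rows of the region inputs: `x₁`, `x₂` and the staircase sites are `ρ`-deep rows of `Ω ⊇ Ω₀`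
  have hΩdeep : ∀ (r : Balaban1983to89.Site P 0),
      (∀ i, ρ ≤ (boxCoord hPd (P.L ^ k) c r i : ℝ) ∧ (boxCoord hPd (P.L ^ k) c r i : ℝ) + ρ ≤ (P.L ^ k * M0 i : ℕ) - 1) →
      ∀ v, v ∉ Ω → ρ ≤ B5Ineq137Torus.T P 0 r v :=
    fun r hr v hv => (lt_T_of_not_mem hPd hfit0 hr (fun h => hv (hΩ h))).le
  have hx₁Ω : x₁ ∈ Ω := hΩ hx₁
  have hx₂Ω : x₂ ∈ Ω := hΩ hx₂
  have hρΩ₁ : ∀ v, v ∉ Ω → ρ ≤ B5Ineq137Torus.T P 0 x₁ v := hΩdeep x₁ (depth_mono hPd (show ρ ≤ R₀ + R by linarith) hdeep₁)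
  have hρΩ₂ : ∀ v, v ∉ Ω → ρ ≤ B5Ineq137Torus.T P 0 x₂ v := hΩdeep x₂ (depth_mono hPd (show ρ ≤ R₀ + R by linarith) hdeep₂)
  -- the staircase sites: within `T12` of `x₂` (and of `x₁`), hence in `Ω₀` at chart depth `≥ R₀ + R − T12 ≥ ρ`
  have hdeep₂T : ∀ i, T12 ≤ (z₂ i : ℝ) ∧ (z₂ i : ℝ) + T12 ≤ (P.L ^ k * M0 i : ℕ) - 1 := fun i => by
    have h1 := hdeep₂ i
    constructor <;> linarith only [h1.1, h1.2, hnear, hR, hρ, hR₀]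
  have stairDeep : ∀ w' : Balaban1983to89.Site P 0, supDist x₂ w' ≤ supDist x₁ x₂ →
      w' ∈ Ω₀ ∧ (∀ i, ρ ≤ (boxCoord hPd (P.L ^ k) c w' i : ℝ) ∧ (boxCoord hPd (P.L ^ k) c w' i : ℝ) + ρ ≤ (P.L ^ k * M0 i : ℕ) - 1) ∧
      B5Ineq137Torus.T P 0 x₂ w' ≤ T12 := by
    intro w' hw
    have hTw : B5Ineq137Torus.T P 0 x₂ w' ≤ T12 := by
      rw [T_eq_supDist P x₂ w', hT12N]; exact_mod_cast hw
    obtain ⟨hmemw, hcoord⟩ := mem_and_abs_sub_le_of_T_le hPd hfit0 hdeep₂T hTw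
    refine ⟨hmemw, fun i => ?_, hTw⟩
    have h1 := hcoord i
    have h2 := hdeep₂ i
    have h3 : ((|z₂ i - boxCoord hPd (P.L ^ k) c w' i| : ℤ) : ℝ) = |((z₂ i : ℤ) : ℝ) - (boxCoord hPd (P.L ^ k) c w' i : ℝ)| := by
      push_cast; rfl
    rw [h3, abs_le] at h1
    constructor <;> linarith only [h1.1, h1.2, h2.1, h2.2, hnear, hR, hR₀]
  have hTw₁ : ∀ w' : Balaban1983to89.Site P 0, supDist x₁ w' ≤ supDist x₁ x₂ → B5Ineq137Torus.T P 0 x₁ w' ≤ T12 := fun w' hw => by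
    rw [T_eq_supDist P x₁ w', hT12N]; exact_mod_cast hw
  -- the support of the sources in `supDist` form
  have hsuppN : ∀ (x : Balaban1983to89.Site P 0) (g : Balaban1983to89.Site P 0 → ℂ) (E' : ℝ),
      (∀ y, g y ≠ 0 → E' ≤ B5Ineq137Torus.T P 0 x y) → ∀ z, g z ≠ 0 → E' ≤ (supDist x z : ℝ) := by
    intro x g E' hg z hz
    rw [← T_eq_supDist P x z]
    exact hg z hz
  -- the support distances fed to the inputs and the exponent bookkeeping
  set Dc : ℝ := max (D - (P.L : ℝ) ^ k) 0 with hDcdef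
  have hDc0 : 0 ≤ Dc := le_max_right _ _
  have hDcD : Dc ≤ D := max_le (by linarith only [hLk]) hD
  have hDc₁ : ∀ y, f y ≠ 0 → Dc ≤ B5Ineq137Torus.T P 0 x₁ y := fun y hy => hDcD.trans (hsupp₁ y hy)
  have hDc₂ : ∀ y, f y ≠ 0 → Dc ≤ B5Ineq137Torus.T P 0 x₂ y := fun y hy => hDcD.trans (hsupp₂ y hy)
  have hDcw : ∀ w' : Balaban1983to89.Site P 0, supDist x₁ w' ≤ supDist x₁ x₂ → ∀ y, f y ≠ 0 → Dc ≤ B5Ineq137Torus.T P 0 w' y := by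
    intro w' hw y hy
    refine max_le ?_ (B5Ineq137Torus.T_nonneg P 0 _ y)
    have h1 := hsupp₁ y hy
    have h2 := B5Ineq137Torus.T_triangle P 0 x₁ w' y
    have h3 := hTw₁ w' hw
    linarith only [h1, h2, h3, hnear]
  set Dt : ℝ := max (max (D - (P.L : ℝ) ^ k) (R₁ - 2 - (P.L : ℝ) ^ k)) 0 with hDtdef
  have hDt0 : 0 ≤ Dt := le_max_right _ _
  have htail : ∀ r : Balaban1983to89.Site P 0, B5Ineq137Torus.T P 0 x₁ r ≤ T12 → B5Ineq137Torus.T P 0 x₂ r ≤ T12 → ∀ y, f y ≠ 0 →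
      (R₁ - 1 < B5Ineq137Torus.T P 0 x₁ y ∨ R₁ - 1 < B5Ineq137Torus.T P 0 x₂ y) → Dt ≤ B5Ineq137Torus.T P 0 r y := by
    intro r hr₁ hr₂ y hy hfar
    have h1 := hsupp₁ y hy
    have h2 := B5Ineq137Torus.T_triangle P 0 x₁ r y
    have h3 := B5Ineq137Torus.T_triangle P 0 x₂ r y
    refine max_le (max_le ?_ ?_) (B5Ineq137Torus.T_nonneg P 0 r y)
    · linarith only [h1, h2, hr₁, hnear]
    · rcases hfar with h7 | h7
      · linarith only [h7, h2, hr₁, hnear]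
      · linarith only [h7, h3, hr₂, hnear]
  have hX : Real.exp (-(δ₀ * (((P.L : ℝ) ^ k)⁻¹ * Dc))) * Real.exp (-(δ₀ * (((P.L : ℝ) ^ k)⁻¹ * (Db + R)))) ≤ GE := by
    rw [hGEdef, heδdef, hEdef, hE2Rdef, ← Real.exp_add, ← Real.exp_add, ← Real.exp_add]
    refine Real.exp_le_exp.2 ?_
    have h1 : D - (P.L : ℝ) ^ k ≤ Dc := le_max_left _ _
    have h2 := mul_le_mul_of_nonneg_left (mul_le_mul_of_nonneg_left h1 hLkinv.le) hδ₀.le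
    have e2 : δ₀ * (((P.L : ℝ) ^ k)⁻¹ * (D - (P.L : ℝ) ^ k)) = δ₀ * (((P.L : ℝ) ^ k)⁻¹ * D) - δ₀ * (((P.L : ℝ) ^ k)⁻¹ * (P.L : ℝ) ^ k) := by
      ring
    rw [e2, hLLk] at h2
    have e1 : δ₀ * (((P.L : ℝ) ^ k)⁻¹ * (Db + R)) =
        δ₀ * (((P.L : ℝ) ^ k)⁻¹ * (2 * R - 1)) - δ₀ * ((P.L : ℝ) ^ k)⁻¹ - δ₀ * (((P.L : ℝ) ^ k)⁻¹ * (P.L : ℝ) ^ k) := by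
      rw [hDbdef]; ring
    rw [hLLk] at e1
    have h3 : 0 ≤ δ₀ * (((P.L : ℝ) ^ k)⁻¹ * D) := by positivity
    have h5 : δ₀ * ((P.L : ℝ) ^ k)⁻¹ ≤ δ₀ := by nlinarith only [hinv1, hδ₀]
    linarith only [h2, e1, h3, h5]
  have hY : Real.exp (-(δ₀ * (((P.L : ℝ) ^ k)⁻¹ * Dt))) ≤ TE := by
    rw [hTEdef, heδdef, hEdef, hER1def, ← Real.exp_add, ← Real.exp_add]
    refine Real.exp_le_exp.2 ?_
    have h1 : D - (P.L : ℝ) ^ k ≤ Dt := (le_max_left _ _).trans (le_max_left _ _)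
    have h2 : R₁ - 2 - (P.L : ℝ) ^ k ≤ Dt := (le_max_right _ _).trans (le_max_left _ _)
    have hsum : D + (R₁ - 1) - 1 - 2 * (P.L : ℝ) ^ k ≤ 2 * Dt := by linarith only [h1, h2]
    have h3 := mul_le_mul_of_nonneg_left (mul_le_mul_of_nonneg_left hsum hLkinv.le) hδ₀.le
    have e3 : δ₀ * (((P.L : ℝ) ^ k)⁻¹ * (D + (R₁ - 1) - 1 - 2 * (P.L : ℝ) ^ k)) =
        δ₀ * (((P.L : ℝ) ^ k)⁻¹ * D) + δ₀ * (((P.L : ℝ) ^ k)⁻¹ * (R₁ - 1)) - δ₀ * ((P.L : ℝ) ^ k)⁻¹ -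
          2 * δ₀ * (((P.L : ℝ) ^ k)⁻¹ * (P.L : ℝ) ^ k) := by ring
    have e4 : δ₀ * (((P.L : ℝ) ^ k)⁻¹ * (2 * Dt)) = 2 * (δ₀ * (((P.L : ℝ) ^ k)⁻¹ * Dt)) := by ring
    rw [e3, e4, hLLk] at h3
    have h5 : δ₀ * ((P.L : ℝ) ^ k)⁻¹ ≤ δ₀ := by nlinarith only [hinv1, hδ₀]
    linarith only [h3, h5, hδ₀]
  have hXc : ∀ {S : ℝ}, 0 ≤ S →
      c₀ * Real.exp (-(δ₀ * (((P.L : ℝ) ^ k)⁻¹ * Dc))) * Real.exp (-(δ₀ * (((P.L : ℝ) ^ k)⁻¹ * (Db + R)))) * S ≤ c₀ * GE * S := by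
    intro S hS
    have := mul_le_mul_of_nonneg_left hX hc₀
    calc c₀ * Real.exp (-(δ₀ * (((P.L : ℝ) ^ k)⁻¹ * Dc))) * Real.exp (-(δ₀ * (((P.L : ℝ) ^ k)⁻¹ * (Db + R)))) * S
        = c₀ * (Real.exp (-(δ₀ * (((P.L : ℝ) ^ k)⁻¹ * Dc))) * Real.exp (-(δ₀ * (((P.L : ℝ) ^ k)⁻¹ * (Db + R))))) * S := by ring
      _ ≤ c₀ * GE * S := mul_le_mul_of_nonneg_right this hS
  have hYc : ∀ {S : ℝ}, 0 ≤ S → c₀ * Real.exp (-(δ₀ * (((P.L : ℝ) ^ k)⁻¹ * Dt))) * S ≤ c₀ * TE * S := fun {S} hS =>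
    mul_le_mul_of_nonneg_right (mul_le_mul_of_nonneg_left hY hc₀) hS
  -- the row sources, bond-difference sources and tails, and their vanishing
  set gs : Balaban1983to89.Site P 0 → ↥(labels (P.L ^ k) M0 s) → Balaban1983to89.Site P 0 → ℂ :=
    fun p α y => (ζ p y : ℂ) * (lamFam hPd (P.L ^ k) c M0 s α p y : ℂ) * f y with hgsdef
  set ds : Balaban1983to89.Site P 0 → Balaban1983to89.Site P 0 → ↥(labels (P.L ^ k) M0 s) → Balaban1983to89.Site P 0 → ℂ :=
    fun p p' α y => ((ζ p' y : ℂ) * (lamFam hPd (P.L ^ k) c M0 s α p' y : ℂ) - (ζ p y : ℂ) * (lamFam hPd (P.L ^ k) c M0 s α p y : ℂ)) * f y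
    with hdsdef
  set q : Balaban1983to89.Site P 0 → Balaban1983to89.Site P 0 → ℂ := fun p y => ((ζ p y : ℂ) - 1) * f y with hqdef
  set dq : Balaban1983to89.Site P 0 → Balaban1983to89.Site P 0 → Balaban1983to89.Site P 0 → ℂ :=
    fun p p' y => ((ζ p' y : ℂ) - (ζ p y : ℂ)) * f y with hdqdef
  have hgs0 : ∀ (p : Balaban1983to89.Site P 0) (α : ↥(labels (P.L ^ k) M0 s)),
      (¬∃ y, ζ p y * lamFam hPd (P.L ^ k) c M0 s α p y ≠ 0) → gs p α = 0 := by
    intro p α hex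
    push Not at hex
    funext y; rw [hgsdef]; dsimp only; rw [← Complex.ofReal_mul, hex y, Complex.ofReal_zero, zero_mul]; rfl
  have hds0 : ∀ (p p' : Balaban1983to89.Site P 0) (α : ↥(labels (P.L ^ k) M0 s)),
      (¬∃ y, ζ p' y * lamFam hPd (P.L ^ k) c M0 s α p' y ≠ 0) → (¬∃ y, ζ p y * lamFam hPd (P.L ^ k) c M0 s α p y ≠ 0) → ds p p' α = 0 := by
    intro p p' α hex' hex
    push Not at hex hex'
    funext y; rw [hdsdef]; dsimp only; rw [← Complex.ofReal_mul, ← Complex.ofReal_mul, hex y, hex' y]; simp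
  have hgs_le : ∀ p α y, ‖gs p α y‖ ≤ F := fun p α y =>
    norm_rowSource_le (hζabs p y) (abs_lam_le_one (sum_abs_lamT_le_one hfit0) α p y) hF y
  have hgs_supp : ∀ p α y, gs p α y ≠ 0 → ζ p y * lamFam hPd (P.L ^ k) c M0 s α p y ≠ 0 ∧ f y ≠ 0 := fun p α y hy => rowSource_ne_zero hy
  have hds_act : ∀ p p' α y, ds p p' α y ≠ 0 →
      ζ p' y * lamFam hPd (P.L ^ k) c M0 s α p' y ≠ 0 ∨ ζ p y * lamFam hPd (P.L ^ k) c M0 s α p y ≠ 0 := by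
    intro p p' α y hy
    by_contra hno
    rw [not_or, not_not, not_not] at hno
    apply hy
    rw [hdsdef]; dsimp only
    rw [← Complex.ofReal_mul, ← Complex.ofReal_mul, hno.1, hno.2]; simp
  have hds_supp : ∀ p p' α y, ds p p' α y ≠ 0 → f y ≠ 0 := fun p p' α y hy => right_ne_zero_of_mul hy
  -- the propagators
  set G₀ := gBox A P.eps⁻¹ U k Ω with hG₀def
  set G : ↥(labels (P.L ^ k) M0 s) → Matrix (Balaban1983to89.Site P 0) (Balaban1983to89.Site P 0) ℂ :=
    fun α => gBox A P.eps⁻¹ U k (cubeFam hPd (P.L ^ k) c M0 s W α) with hGdef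
  set Ec : ℂ := ((P.eps⁻¹ : ℝ) : ℂ) with hEcdef
  have hEc : ‖Ec‖ = P.eps⁻¹ := by rw [hEcdef, Complex.norm_real, Real.norm_eq_abs, abs_of_pos (inv_pos.mpr heps)]
  set τ : ℂ := stairHol U x₁ x₂ with hτdef
  have hτ1 : ‖τ‖ = 1 := norm_stairHol U x₁ x₂
  -- the (2.32) bond identity at both bonds (row hypothesis (i) at the four end points)
  have hid₁ : covD P.eps⁻¹ (cfg U) (gLocT A P.eps⁻¹ U k (cubeFam hPd (P.L ^ k) c M0 s W) (lamFam hPd (P.L ^ k) c M0 s) ζ *ᵥ f) ⟨x₁, μ⟩ -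
      covD P.eps⁻¹ (cfg U) (G₀ *ᵥ f) ⟨x₁, μ⟩ =
      ∑ α, (covD P.eps⁻¹ (cfg U) (G α *ᵥ gs x₁' α) ⟨x₁, μ⟩ - covD P.eps⁻¹ (cfg U) (G₀ *ᵥ gs x₁' α) ⟨x₁, μ⟩) +
      ∑ α, Ec * ((G α *ᵥ ds x₁ x₁' α) x₁ - (G₀ *ᵥ ds x₁ x₁' α) x₁) +
      covD P.eps⁻¹ (cfg U) (G₀ *ᵥ q x₁') ⟨x₁, μ⟩ + Ec * (G₀ *ᵥ dq x₁ x₁') x₁ :=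
    covD_gLocT_sub_apply P.eps⁻¹ (cfg U) A P.eps⁻¹ U k (cubeFam hPd (P.L ^ k) c M0 s W) (lamFam hPd (P.L ^ k) c M0 s) ζ G₀ f ⟨x₁, μ⟩
      (rowHyp_i hPd hfit0 hζ0 hx₁e hdeep₁e0) (rowHyp_i hPd hfit0 hζ0 hx₁ hdeep₁0)
  have hid₂ : covD P.eps⁻¹ (cfg U) (gLocT A P.eps⁻¹ U k (cubeFam hPd (P.L ^ k) c M0 s W) (lamFam hPd (P.L ^ k) c M0 s) ζ *ᵥ f) ⟨x₂, μ⟩ -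
      covD P.eps⁻¹ (cfg U) (G₀ *ᵥ f) ⟨x₂, μ⟩ =
      ∑ α, (covD P.eps⁻¹ (cfg U) (G α *ᵥ gs x₂' α) ⟨x₂, μ⟩ - covD P.eps⁻¹ (cfg U) (G₀ *ᵥ gs x₂' α) ⟨x₂, μ⟩) +
      ∑ α, Ec * ((G α *ᵥ ds x₂ x₂' α) x₂ - (G₀ *ᵥ ds x₂ x₂' α) x₂) +
      covD P.eps⁻¹ (cfg U) (G₀ *ᵥ q x₂') ⟨x₂, μ⟩ + Ec * (G₀ *ᵥ dq x₂ x₂') x₂ :=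
    covD_gLocT_sub_apply P.eps⁻¹ (cfg U) A P.eps⁻¹ U k (cubeFam hPd (P.L ^ k) c M0 s W) (lamFam hPd (P.L ^ k) c M0 s) ζ G₀ f ⟨x₂, μ⟩
      (rowHyp_i hPd hfit0 hζ0 hx₂e hdeep₂e0) (rowHyp_i hPd hfit0 hζ0 hx₂ hdeep₂0)
  rw [hid₁, hid₂]
  -- the eight families of summands
  set sA : ↥(labels (P.L ^ k) M0 s) → ℂ := fun α =>
    τ * (covD P.eps⁻¹ (cfg U) (G α *ᵥ gs x₂' α) ⟨x₂, μ⟩ - covD P.eps⁻¹ (cfg U) (G₀ *ᵥ gs x₂' α) ⟨x₂, μ⟩) -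
      (covD P.eps⁻¹ (cfg U) (G α *ᵥ gs x₂' α) ⟨x₁, μ⟩ - covD P.eps⁻¹ (cfg U) (G₀ *ᵥ gs x₂' α) ⟨x₁, μ⟩) with hsAdef
  set sB : ↥(labels (P.L ^ k) M0 s) → ℂ := fun α =>
    (covD P.eps⁻¹ (cfg U) (G α *ᵥ gs x₂' α) ⟨x₁, μ⟩ - covD P.eps⁻¹ (cfg U) (G₀ *ᵥ gs x₂' α) ⟨x₁, μ⟩) -
      (covD P.eps⁻¹ (cfg U) (G α *ᵥ gs x₁' α) ⟨x₁, μ⟩ - covD P.eps⁻¹ (cfg U) (G₀ *ᵥ gs x₁' α) ⟨x₁, μ⟩) with hsBdef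
  set sC : ↥(labels (P.L ^ k) M0 s) → ℂ := fun α =>
    τ * (Ec * ((G α *ᵥ ds x₂ x₂' α) x₂ - (G₀ *ᵥ ds x₂ x₂' α) x₂)) - Ec * ((G α *ᵥ ds x₂ x₂' α) x₁ - (G₀ *ᵥ ds x₂ x₂' α) x₁)
    with hsCdef
  set sD : ↥(labels (P.L ^ k) M0 s) → ℂ := fun α =>
    Ec * ((G α *ᵥ ds x₂ x₂' α) x₁ - (G₀ *ᵥ ds x₂ x₂' α) x₁) - Ec * ((G α *ᵥ ds x₁ x₁' α) x₁ - (G₀ *ᵥ ds x₁ x₁' α) x₁) with hsDdef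
  set tA : ℂ := τ * covD P.eps⁻¹ (cfg U) (G₀ *ᵥ q x₂') ⟨x₂, μ⟩ - covD P.eps⁻¹ (cfg U) (G₀ *ᵥ q x₂') ⟨x₁, μ⟩ with htAdef
  set tB : ℂ := covD P.eps⁻¹ (cfg U) (G₀ *ᵥ q x₂') ⟨x₁, μ⟩ - covD P.eps⁻¹ (cfg U) (G₀ *ᵥ q x₁') ⟨x₁, μ⟩ with htBdef
  set tC : ℂ := τ * (Ec * (G₀ *ᵥ dq x₂ x₂') x₂) - Ec * (G₀ *ᵥ dq x₂ x₂') x₁ with htCdef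
  set tD : ℂ := Ec * (G₀ *ᵥ dq x₂ x₂') x₁ - Ec * (G₀ *ᵥ dq x₁ x₁') x₁ with htDdef
  have hdecomp : τ * (∑ α, (covD P.eps⁻¹ (cfg U) (G α *ᵥ gs x₂' α) ⟨x₂, μ⟩ - covD P.eps⁻¹ (cfg U) (G₀ *ᵥ gs x₂' α) ⟨x₂, μ⟩) +
        ∑ α, Ec * ((G α *ᵥ ds x₂ x₂' α) x₂ - (G₀ *ᵥ ds x₂ x₂' α) x₂) +
        covD P.eps⁻¹ (cfg U) (G₀ *ᵥ q x₂') ⟨x₂, μ⟩ + Ec * (G₀ *ᵥ dq x₂ x₂') x₂) -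
      (∑ α, (covD P.eps⁻¹ (cfg U) (G α *ᵥ gs x₁' α) ⟨x₁, μ⟩ - covD P.eps⁻¹ (cfg U) (G₀ *ᵥ gs x₁' α) ⟨x₁, μ⟩) +
        ∑ α, Ec * ((G α *ᵥ ds x₁ x₁' α) x₁ - (G₀ *ᵥ ds x₁ x₁' α) x₁) +
        covD P.eps⁻¹ (cfg U) (G₀ *ᵥ q x₁') ⟨x₁, μ⟩ + Ec * (G₀ *ᵥ dq x₁ x₁') x₁) =
      ((∑ α, sA α + ∑ α, sB α) + (∑ α, sC α + ∑ α, sD α)) + ((tA + tB) + (tC + tD)) := by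
    have eAB : ∑ α, sA α + ∑ α, sB α =
        τ * ∑ α, (covD P.eps⁻¹ (cfg U) (G α *ᵥ gs x₂' α) ⟨x₂, μ⟩ - covD P.eps⁻¹ (cfg U) (G₀ *ᵥ gs x₂' α) ⟨x₂, μ⟩) -
          ∑ α, (covD P.eps⁻¹ (cfg U) (G α *ᵥ gs x₁' α) ⟨x₁, μ⟩ - covD P.eps⁻¹ (cfg U) (G₀ *ᵥ gs x₁' α) ⟨x₁, μ⟩) := by
      rw [← Finset.sum_add_distrib, Finset.mul_sum, ← Finset.sum_sub_distrib]
      refine Finset.sum_congr rfl fun α _ => ?_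
      simp only [hsAdef, hsBdef]; ring
    have eCD : ∑ α, sC α + ∑ α, sD α =
        τ * ∑ α, Ec * ((G α *ᵥ ds x₂ x₂' α) x₂ - (G₀ *ᵥ ds x₂ x₂' α) x₂) -
          ∑ α, Ec * ((G α *ᵥ ds x₁ x₁' α) x₁ - (G₀ *ᵥ ds x₁ x₁' α) x₁) := by
      rw [← Finset.sum_add_distrib, Finset.mul_sum, ← Finset.sum_sub_distrib]
      refine Finset.sum_congr rfl fun α _ => ?_
      simp only [hsCdef, hsDdef]; ring
    rw [eAB, eCD]
    simp only [htAdef, htBdef, htCdef, htDdef]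
    ring
  /- TERM A: (H5) — the Hölder member of (1.11)–(1.12) for each cube active at `x₂'`, on its fixed row source -/
  set BA : ℝ := P.spacing k * (c₀ * GE * F) with hBAdef
  have hBA0 : 0 ≤ BA := by rw [hBAdef]; positivity
  have hsA0 : ∀ α, gs x₂' α = 0 → sA α = 0 := fun α h0 => by
    simp only [hsAdef]; rw [h0, mulVec_zero, mulVec_zero]; simp only [covD_zero, sub_self, mul_zero]
  have htermA : ∀ α, w * ‖sA α‖ ≤ BA := by
    intro α
    by_cases hex : ∃ y, ζ x₂' y * lamFam hPd (P.L ^ k) c M0 s α x₂' y ≠ 0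
    · -- both points in the cube, `ρ`-deep; the source inside, `R`-deep
      have hx₂α : x₂ ∈ cubeFam hPd (P.L ^ k) c M0 s W α := nearα x₂' hx₂e hdeep₂e α hex x₂ (by linarith only [hT2'2, hR1])
      have hx₁α : x₁ ∈ cubeFam hPd (P.L ^ k) c M0 s W α := nearα x₂' hx₂e hdeep₂e α hex x₁ (by linarith only [hT2'1, hnear, hR, hρ])
      have hρ₁ : ∀ v, v ∉ cubeFam hPd (P.L ^ k) c M0 s W α → ρ ≤ B5Ineq137Torus.T P 0 x₁ v :=
        depthαρ x₂' hx₂e hdeep₂e α hex x₁ (by linarith only [hT2'1, hnear])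
      have hρ₂ : ∀ v, v ∉ cubeFam hPd (P.L ^ k) c M0 s W α → ρ ≤ B5Ineq137Torus.T P 0 x₂ v :=
        depthαρ x₂' hx₂e hdeep₂e α hex x₂ (by linarith only [hT2'2, hLk])
      have hDb₁ : ∀ v, v ∉ cubeFam hPd (P.L ^ k) c M0 s W α → Db ≤ B5Ineq137Torus.T P 0 x₁ v :=
        depthα x₂' hx₂e hdeep₂e α hex x₁ (by linarith only [hT2'1, hnear])
      have hDb₂ : ∀ v, v ∉ cubeFam hPd (P.L ^ k) c M0 s W α → Db ≤ B5Ineq137Torus.T P 0 x₂ v :=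
        depthα x₂' hx₂e hdeep₂e α hex x₂ (by linarith only [hT2'2, hLk])
      have hsuppα : ∀ y, y ∉ cubeFam hPd (P.L ^ k) c M0 s W α → gs x₂' α y = 0 := by
        intro y hy
        by_contra hne'
        exact hy (srcα x₂' hx₂e hdeep₂e α y (hgs_supp x₂' α y hne').1).1
      have hDf : ∀ y, gs x₂' α y ≠ 0 → ∀ v, v ∉ cubeFam hPd (P.L ^ k) c M0 s W α → R ≤ B5Ineq137Torus.T P 0 y v :=
        fun y hy v hv => (srcα x₂' hx₂e hdeep₂e α y (hgs_supp x₂' α y hy).1).2 v hv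
      obtain ⟨c', M', hM', hfit', hN', hcα⟩ := cubeFam_fits (hPd := hPd) (s := s) (W := W) hM0 hfit0 hN0 α
      have hsubΩ : (cubeT hPd (P.L ^ k) c' fun i => P.L ^ k * M' i) ⊆ Ω := hcα ▸ (cubeOf_subset α.1).trans hΩ
      rw [hcα] at hx₁α hx₂α hρ₁ hρ₂ hDb₁ hDb₂ hsuppα hDf
      have key := H5 c' M' hM' hfit' hN' hsubΩ x₁ x₂ μ hne12 hx₁α hx₂α hρ₁ hρ₂ (gs x₂' α) F Dc Db R (hgs_le x₂' α) hsuppα hDc0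
        (fun y hy => hDc₁ y (hgs_supp x₂' α y hy).2) (fun y hy => hDc₂ y (hgs_supp x₂' α y hy).2) hDb0 hDb₁ hDb₂ hR0 hDf
      rw [← hcα, covD_sub, covD_sub] at key
      exact key.trans (mul_le_mul_of_nonneg_left (hXc hF0) hsp0.le)
    · rw [hsA0 α (hgs0 x₂' α hex), norm_zero, mul_zero]; exact hBA0
  have hzeroA : ∀ α, α ∉ S x₂' → sA α = 0 := fun α hα =>
    hsA0 α (hgs0 x₂' α fun ⟨y, hy⟩ => hα (hS x₂' hdeep₂e0 α y hy))
  have hsumA : w * ‖∑ α, sA α‖ ≤ m * BA := by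
    rw [← Finset.sum_subset (Finset.subset_univ (S x₂')) (fun α _ hα => hzeroA α hα)]
    calc w * ‖∑ α ∈ S x₂', sA α‖ ≤ w * ∑ α ∈ S x₂', ‖sA α‖ := mul_le_mul_of_nonneg_left (norm_sum_le _ _) hw0
      _ = ∑ α ∈ S x₂', w * ‖sA α‖ := Finset.mul_sum _ _ _
      _ ≤ ∑ α ∈ S x₂', BA := Finset.sum_le_sum fun α _ => htermA α
      _ = (S x₂').card * BA := by rw [Finset.sum_const, nsmul_eq_mul]
      _ ≤ m * BA := mul_le_mul_of_nonneg_right (hcard x₂') hBA0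
  /- TERM B: (H1) at `⟨x₁, x₁+e_μ⟩` on the difference of the row sources of `x₂'` and `x₁'` -/
  set Λ₁ : ℝ := K₁ / (R₀ - R₁) + 3 * Real.pi * (d + 1 : ℕ) / (2 * s) with hΛ₁def
  have hΛ₁0 : 0 ≤ Λ₁ := by rw [hΛ₁def]; positivity
  set dB : ↥(labels (P.L ^ k) M0 s) → Balaban1983to89.Site P 0 → ℂ := fun α y =>
    ((ζ x₂' y * lamFam hPd (P.L ^ k) c M0 s α x₂' y - ζ x₁' y * lamFam hPd (P.L ^ k) c M0 s α x₁' y : ℝ) : ℂ) * f y with hdBdef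
  have hdB : ∀ α, gs x₂' α - gs x₁' α = dB α := fun α => by
    funext y; simp only [hgsdef, hdBdef, Pi.sub_apply]; push_cast; ring
  have hsB_eq : ∀ α, sB α = covD P.eps⁻¹ (cfg U) (G α *ᵥ dB α) ⟨x₁, μ⟩ - covD P.eps⁻¹ (cfg U) (G₀ *ᵥ dB α) ⟨x₁, μ⟩ := fun α => by
    simp only [hsBdef]; rw [← hdB α, Matrix.mulVec_sub, Matrix.mulVec_sub, covD_sub, covD_sub]; ring
  have hdB_le : ∀ α y, ‖dB α y‖ ≤ Λ₁ * (((d : ℝ) + 1) * T12) * F := by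
    intro α y
    have h1 := abs_weight_shift_sub_le_of_hull (hPd := hPd) (c := c) hs0 hfit0 hN0 hK₁' hζabs hζ1 α.1 hz₁ hz₂ hroom₁ hroom₂ μ y
    rw [hxz₁, hxz₂] at h1
    simp only [hdBdef]
    rw [norm_mul, Complex.norm_real, Real.norm_eq_abs]
    refine mul_le_mul (h1.trans ?_) (hF y) (norm_nonneg _) (by positivity)
    exact mul_le_mul_of_nonneg_left hl1 hΛ₁0
  have hdB_act : ∀ α y, dB α y ≠ 0 →
      ζ x₂' y * lamFam hPd (P.L ^ k) c M0 s α x₂' y ≠ 0 ∨ ζ x₁' y * lamFam hPd (P.L ^ k) c M0 s α x₁' y ≠ 0 := by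
    intro α y hy
    by_contra hno
    rw [not_or, not_not, not_not] at hno
    apply hy
    simp only [hdBdef]; rw [hno.1, hno.2]; simp
  have hdB_supp : ∀ α y, dB α y ≠ 0 → f y ≠ 0 := fun α y hy => right_ne_zero_of_mul hy
  set BB : ℝ := P.spacing k * (c₀ * GE * (Λ₁ * (((d : ℝ) + 1) * T12) * F)) with hBBdef
  have hBB0 : 0 ≤ BB := by rw [hBBdef]; positivity
  have htermB : ∀ α, ‖sB α‖ ≤ BB := by
    intro α
    by_cases hex : (∃ y, ζ x₂' y * lamFam hPd (P.L ^ k) c M0 s α x₂' y ≠ 0) ∨ (∃ y, ζ x₁' y * lamFam hPd (P.L ^ k) c M0 s α x₁' y ≠ 0)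
    · -- the active end point `p ∈ {x₂', x₁'}`: `x₁`, `x₁'` within `L^k + 2` of it
      have hP : ∃ p : Balaban1983to89.Site P 0, p ∈ Ω₀ ∧
          (∀ i, R₀ + R ≤ (boxCoord hPd (P.L ^ k) c p i : ℝ) ∧ (boxCoord hPd (P.L ^ k) c p i : ℝ) + (R₀ + R) ≤ (P.L ^ k * M0 i : ℕ) - 1) ∧
          (∃ y, ζ p y * lamFam hPd (P.L ^ k) c M0 s α p y ≠ 0) ∧
          B5Ineq137Torus.T P 0 p x₁ ≤ (P.L : ℝ) ^ k + 1 ∧ B5Ineq137Torus.T P 0 p x₁' ≤ (P.L : ℝ) ^ k + 2 := by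
        rcases hex with hex | hex
        · exact ⟨x₂', hx₂e, hdeep₂e, hex, by linarith only [hT2'1, hnear], by linarith only [hT2'1', hnear]⟩
        · refine ⟨x₁', hx₁e, hdeep₁e, hex, by linarith only [hT1'1, hLk1], ?_⟩
          rw [B5Ineq137Torus.T_self]; positivity
      obtain ⟨p, hp, hdp, hexp, hpx₁, hpx₁'⟩ := hP
      have hx₁α : x₁ ∈ cubeFam hPd (P.L ^ k) c M0 s W α := nearα p hp hdp α hexp x₁ (by linarith only [hpx₁, hR, hρ])
      have hx₁'α : x₁' ∈ cubeFam hPd (P.L ^ k) c M0 s W α := nearα p hp hdp α hexp x₁' (by linarith only [hpx₁', hR, hρ])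
      have hρ₁ : ∀ v, v ∉ cubeFam hPd (P.L ^ k) c M0 s W α → ρ ≤ B5Ineq137Torus.T P 0 x₁ v :=
        depthαρ p hp hdp α hexp x₁ (by linarith only [hpx₁])
      have hDb₁ : ∀ v, v ∉ cubeFam hPd (P.L ^ k) c M0 s W α → Db ≤ B5Ineq137Torus.T P 0 x₁ v :=
        depthα p hp hdp α hexp x₁ (by linarith only [hpx₁])
      have hsuppα : ∀ y, y ∉ cubeFam hPd (P.L ^ k) c M0 s W α → dB α y = 0 := by
        intro y hy
        by_contra hne'
        rcases hdB_act α y hne' with h1 | h1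
        · exact hy (srcα x₂' hx₂e hdeep₂e α y h1).1
        · exact hy (srcα x₁' hx₁e hdeep₁e α y h1).1
      have hDf : ∀ y, dB α y ≠ 0 → ∀ v, v ∉ cubeFam hPd (P.L ^ k) c M0 s W α → R ≤ B5Ineq137Torus.T P 0 y v := by
        intro y hy v hv
        rcases hdB_act α y hy with h1 | h1
        · exact (srcα x₂' hx₂e hdeep₂e α y h1).2 v hv
        · exact (srcα x₁' hx₁e hdeep₁e α y h1).2 v hv
      obtain ⟨c', M', hM', hfit', hN', hcα⟩ := cubeFam_fits (hPd := hPd) (s := s) (W := W) hM0 hfit0 hN0 α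
      have hsubΩ : (cubeT hPd (P.L ^ k) c' fun i => P.L ^ k * M' i) ⊆ Ω := hcα ▸ (cubeOf_subset α.1).trans hΩ
      rw [hcα] at hx₁α hx₁'α hρ₁ hDb₁ hsuppα hDf
      have key := H1 c' M' hM' hfit' hN' hsubΩ x₁ μ hx₁α hx₁'α hρ₁ (dB α) (Λ₁ * (((d : ℝ) + 1) * T12) * F) Dc Db R (hdB_le α)
        hsuppα hDc0 (fun y hy => hDc₁ y (hdB_supp α y hy)) hDb0 hDb₁ hR0 hDf
      rw [← hcα] at key
      rw [hsB_eq α]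
      exact key.trans (mul_le_mul_of_nonneg_left (hXc (by positivity)) hsp0.le)
    · push Not at hex
      simp only [hsBdef]
      rw [hgs0 x₂' α (not_exists.2 fun y hy => hy (hex.1 y)), hgs0 x₁' α (not_exists.2 fun y hy => hy (hex.2 y))]
      simp only [mulVec_zero, covD_zero, sub_self, norm_zero]
      exact hBB0
  have hzeroB : ∀ α, α ∉ S x₂' ∪ S x₁' → sB α = 0 := by
    intro α hα
    rw [Finset.mem_union, not_or] at hα
    simp only [hsBdef]
    rw [hgs0 x₂' α fun ⟨y, hy⟩ => hα.1 (hS x₂' hdeep₂e0 α y hy), hgs0 x₁' α fun ⟨y, hy⟩ => hα.2 (hS x₁' hdeep₁e0 α y hy)]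
    simp only [mulVec_zero, covD_zero, sub_self]
  have hsumB : ‖∑ α, sB α‖ ≤ 2 * m * BB := by
    rw [← Finset.sum_subset (Finset.subset_univ (S x₂' ∪ S x₁')) (fun α _ hα => hzeroB α hα)]
    have hcardU : (((S x₂' ∪ S x₁').card : ℕ) : ℝ) ≤ 2 * m := by
      have h1 : (((S x₂' ∪ S x₁').card : ℕ) : ℝ) ≤ ((S x₂').card : ℝ) + ((S x₁').card : ℝ) := by
        exact_mod_cast Finset.card_union_le _ _
      linarith only [h1, hcard x₂', hcard x₁']
    calc ‖∑ α ∈ S x₂' ∪ S x₁', sB α‖ ≤ ∑ α ∈ S x₂' ∪ S x₁', ‖sB α‖ := norm_sum_le _ _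
      _ ≤ ∑ α ∈ S x₂' ∪ S x₁', BB := Finset.sum_le_sum fun α _ => htermB α
      _ = (S x₂' ∪ S x₁').card * BB := by rw [Finset.sum_const, nsmul_eq_mul]
      _ ≤ 2 * m * BB := mul_le_mul_of_nonneg_right hcardU hBB0
  /- TERM C: the transported difference of the values of `(G_α − G₀)(Δ_μ-source of x₂)` between `x₁` and `x₂`, telescoped along the staircase, (H1) per bond -/
  have hds_le : ∀ α y, ‖ds x₂ x₂' α y‖ ≤ Λ₁ * F := fun α y =>
    norm_rowSource_sub_le_of_lipschitz hPd hs0 hfit0 hN0 hK₁' hζabs (fun y => hζ1 x₂ y μ) α.1 hx₂ hx₂e hF y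
  set BC : ℝ := P.spacing k * (c₀ * GE * (Λ₁ * F)) with hBCdef
  have hBC0 : 0 ≤ BC := by rw [hBCdef]; positivity
  have htermC : ∀ α, ‖sC α‖ ≤ BC * (((d : ℝ) + 1) * T12) := by
    intro α
    by_cases hex : (∃ y, ζ x₂' y * lamFam hPd (P.L ^ k) c M0 s α x₂' y ≠ 0) ∨ (∃ y, ζ x₂ y * lamFam hPd (P.L ^ k) c M0 s α x₂ y ≠ 0)
    · have hP : ∃ p : Balaban1983to89.Site P 0, p ∈ Ω₀ ∧
          (∀ i, R₀ + R ≤ (boxCoord hPd (P.L ^ k) c p i : ℝ) ∧ (boxCoord hPd (P.L ^ k) c p i : ℝ) + (R₀ + R) ≤ (P.L ^ k * M0 i : ℕ) - 1) ∧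
          (∃ y, ζ p y * lamFam hPd (P.L ^ k) c M0 s α p y ≠ 0) ∧ B5Ineq137Torus.T P 0 p x₂ ≤ 1 := by
        rcases hex with hex | hex
        · exact ⟨x₂', hx₂e, hdeep₂e, hex, hT2'2⟩
        · exact ⟨x₂, hx₂, hdeep₂, hex, by rw [B5Ineq137Torus.T_self]; exact zero_le_one⟩
      obtain ⟨p, hp, hdp, hexp, hpx₂⟩ := hP
      have hsuppα : ∀ y, y ∉ cubeFam hPd (P.L ^ k) c M0 s W α → ds x₂ x₂' α y = 0 := by
        intro y hy
        by_contra hne'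
        rcases hds_act x₂ x₂' α y hne' with h1 | h1
        · exact hy (srcα x₂' hx₂e hdeep₂e α y h1).1
        · exact hy (srcα x₂ hx₂ hdeep₂ α y h1).1
      have hDf : ∀ y, ds x₂ x₂' α y ≠ 0 → ∀ v, v ∉ cubeFam hPd (P.L ^ k) c M0 s W α → R ≤ B5Ineq137Torus.T P 0 y v := by
        intro y hy v hv
        rcases hds_act x₂ x₂' α y hy with h1 | h1
        · exact (srcα x₂' hx₂e hdeep₂e α y h1).2 v hv
        · exact (srcα x₂ hx₂ hdeep₂ α y h1).2 v hv
      obtain ⟨c', M', hM', hfit', hN', hcα⟩ := cubeFam_fits (hPd := hPd) (s := s) (W := W) hM0 hfit0 hN0 α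
      have hsubΩ : (cubeT hPd (P.L ^ k) c' fun i => P.L ^ k * M' i) ⊆ Ω := hcα ▸ (cubeOf_subset α.1).trans hΩ
      -- the bond bound along the staircase
      set ψ : Balaban1983to89.Site P 0 → ℂ := G α *ᵥ ds x₂ x₂' α - G₀ *ᵥ ds x₂ x₂' α with hψdef
      have hbond : ∀ (w' : Balaban1983to89.Site P 0) (m' : Fin P.d), supDist x₁ w' ≤ supDist x₁ x₂ → supDist x₂ w' ≤ supDist x₁ x₂ →
          ‖covD P.eps⁻¹ (cfg U) ψ ⟨w', m'⟩‖ ≤ BC := by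
        intro w' m' hw1 hw2
        obtain ⟨-, -, hTw⟩ := stairDeep w' hw2
        have hpw : B5Ineq137Torus.T P 0 p w' ≤ (P.L : ℝ) ^ k + 1 := by
          have h1 := B5Ineq137Torus.T_triangle P 0 p x₂ w'; linarith only [h1, hpx₂, hTw, hnear]
        have hw'α : w' ∈ cubeFam hPd (P.L ^ k) c M0 s W α := nearα p hp hdp α hexp w' (by linarith only [hpw, hR, hρ])
        have hw'eα : w'.shift m' ∈ cubeFam hPd (P.L ^ k) c M0 s W α :=
          nearα p hp hdp α hexp (w'.shift m') (by linarith only [hTshift p w' m', hpw, hR, hρ])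
        have hρw : ∀ v, v ∉ cubeFam hPd (P.L ^ k) c M0 s W α → ρ ≤ B5Ineq137Torus.T P 0 w' v :=
          depthαρ p hp hdp α hexp w' (by linarith only [hpw])
        have hDbw : ∀ v, v ∉ cubeFam hPd (P.L ^ k) c M0 s W α → Db ≤ B5Ineq137Torus.T P 0 w' v :=
          depthα p hp hdp α hexp w' (by linarith only [hpw])
        rw [hcα] at hw'α hw'eα hρw hDbw
        have hsuppα' := hsuppα
        have hDf' := hDf
        rw [hcα] at hsuppα' hDf'
        have key := H1 c' M' hM' hfit' hN' hsubΩ w' m' hw'α hw'eα hρw (ds x₂ x₂' α) (Λ₁ * F) Dc Db R (hds_le α) hsuppα' hDc0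
          (fun y hy => hDcw w' hw1 y (hds_supp x₂ x₂' α y hy)) hDb0 hDbw hR0 hDf'
        rw [← hcα] at key
        rw [hψdef, covD_sub]
        exact key.trans (mul_le_mul_of_nonneg_left (hXc (by positivity)) hsp0.le)
      have htel := norm_stairHol_mul_sub_le_of_near U (inv_ne_zero heps.ne') ψ x₁ x₂ hBC0 hbond
      rw [abs_inv, abs_of_pos heps, inv_inv, ← hT12N, hPdR] at htel
      have e : sC α = Ec * (τ * ψ x₂ - ψ x₁) := by simp only [hsCdef, hψdef, Pi.sub_apply]; ring
      rw [e, norm_mul, hEc, hτdef]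
      calc P.eps⁻¹ * ‖stairHol U x₁ x₂ * ψ x₂ - ψ x₁‖
          ≤ P.eps⁻¹ * (P.eps * BC * (((d : ℝ) + 1) * T12)) := mul_le_mul_of_nonneg_left htel (inv_pos.mpr heps).le
        _ = BC * (((d : ℝ) + 1) * T12) := by rw [← mul_assoc, ← mul_assoc P.eps⁻¹, inv_mul_cancel₀ heps.ne', one_mul]
    · push Not at hex
      simp only [hsCdef]
      rw [hds0 x₂ x₂' α (not_exists.2 fun y hy => hy (hex.1 y)) (not_exists.2 fun y hy => hy (hex.2 y))]
      simp only [mulVec_zero, Pi.zero_apply, mul_zero, sub_zero, norm_zero]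
      positivity
  have hzeroC : ∀ α, α ∉ S x₂' ∪ S x₂ → sC α = 0 := by
    intro α hα
    rw [Finset.mem_union, not_or] at hα
    simp only [hsCdef]
    rw [hds0 x₂ x₂' α (fun ⟨y, hy⟩ => hα.1 (hS x₂' hdeep₂e0 α y hy)) (fun ⟨y, hy⟩ => hα.2 (hS x₂ hdeep₂0 α y hy))]
    simp only [mulVec_zero, Pi.zero_apply, mul_zero, sub_zero]
  have hsumC : ‖∑ α, sC α‖ ≤ 2 * m * (BC * (((d : ℝ) + 1) * T12)) := by
    rw [← Finset.sum_subset (Finset.subset_univ (S x₂' ∪ S x₂)) (fun α _ hα => hzeroC α hα)]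
    have hcardU : (((S x₂' ∪ S x₂).card : ℕ) : ℝ) ≤ 2 * m := by
      have h1 : (((S x₂' ∪ S x₂).card : ℕ) : ℝ) ≤ ((S x₂').card : ℝ) + ((S x₂).card : ℝ) := by
        exact_mod_cast Finset.card_union_le _ _
      linarith only [h1, hcard x₂', hcard x₂]
    calc ‖∑ α ∈ S x₂' ∪ S x₂, sC α‖ ≤ ∑ α ∈ S x₂' ∪ S x₂, ‖sC α‖ := norm_sum_le _ _
      _ ≤ ∑ α ∈ S x₂' ∪ S x₂, BC * (((d : ℝ) + 1) * T12) := Finset.sum_le_sum fun α _ => htermC α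
      _ = (S x₂' ∪ S x₂).card * (BC * (((d : ℝ) + 1) * T12)) := by rw [Finset.sum_const, nsmul_eq_mul]
      _ ≤ 2 * m * (BC * (((d : ℝ) + 1) * T12)) := mul_le_mul_of_nonneg_right hcardU (by positivity)
  /- TERM D: (H2) on the difference of the bond-difference sources of `x₂` and `x₁` (second difference of the row weights) -/
  set Λ₂ : ℝ := K₂ / (R₀ - R₁) ^ 2 + 4 * Real.pi ^ 2 / (s : ℝ) ^ 2 + 2 * (K₁ / (R₀ - R₁) * (3 * Real.pi * (d + 1 : ℕ) / (2 * s)))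
    with hΛ₂def
  have hΛ₂0 : 0 ≤ Λ₂ := by rw [hΛ₂def]; positivity
  set dD : ↥(labels (P.L ^ k) M0 s) → Balaban1983to89.Site P 0 → ℂ := fun α y =>
    (((ζ x₂' y * lamFam hPd (P.L ^ k) c M0 s α x₂' y - ζ x₂ y * lamFam hPd (P.L ^ k) c M0 s α x₂ y) -
        (ζ x₁' y * lamFam hPd (P.L ^ k) c M0 s α x₁' y - ζ x₁ y * lamFam hPd (P.L ^ k) c M0 s α x₁ y) : ℝ) : ℂ) * f y with hdDdef
  have hdD : ∀ α, ds x₂ x₂' α - ds x₁ x₁' α = dD α := fun α => by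
    funext y; simp only [hdsdef, hdDdef, Pi.sub_apply]; push_cast; ring
  have hsD_eq : ∀ α, sD α = Ec * ((G α *ᵥ dD α) x₁ - (G₀ *ᵥ dD α) x₁) := fun α => by
    simp only [hsDdef]; rw [← hdD α, Matrix.mulVec_sub, Matrix.mulVec_sub, Pi.sub_apply, Pi.sub_apply]; ring
  have hdD_le : ∀ α y, ‖dD α y‖ ≤ Λ₂ * (((d : ℝ) + 1) * T12) * F := by
    intro α y
    have h1 := abs_weight_bondDiff_sub_le_of_hull (hPd := hPd) (c := c) hs0 hfit0 hN0 hζabs hζ1 hζ2 α.1 hz₁ hz₂ hroom₁ hroom₂ μ y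
    rw [hxz₁, hxz₂] at h1
    simp only [hdDdef]
    rw [norm_mul, Complex.norm_real, Real.norm_eq_abs]
    refine mul_le_mul (h1.trans ?_) (hF y) (norm_nonneg _) (by positivity)
    exact mul_le_mul_of_nonneg_left hl1 hΛ₂0
  have hdD_act : ∀ α y, dD α y ≠ 0 →
      (ζ x₂' y * lamFam hPd (P.L ^ k) c M0 s α x₂' y ≠ 0 ∨ ζ x₂ y * lamFam hPd (P.L ^ k) c M0 s α x₂ y ≠ 0) ∨
      (ζ x₁' y * lamFam hPd (P.L ^ k) c M0 s α x₁' y ≠ 0 ∨ ζ x₁ y * lamFam hPd (P.L ^ k) c M0 s α x₁ y ≠ 0) := by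
    intro α y hy
    by_contra hno
    simp only [not_or, not_not] at hno
    apply hy
    simp only [hdDdef]; rw [hno.1.1, hno.1.2, hno.2.1, hno.2.2]; simp
  have hdD_supp : ∀ α y, dD α y ≠ 0 → f y ≠ 0 := fun α y hy => right_ne_zero_of_mul hy
  set BD : ℝ := P.spacing k ^ 2 * (c₀ * GE * (Λ₂ * (((d : ℝ) + 1) * T12) * F)) with hBDdef
  have hBD0 : 0 ≤ BD := by rw [hBDdef]; positivity
  have htermD : ∀ α, ‖sD α‖ ≤ P.eps⁻¹ * BD := by
    intro α
    by_cases hex : ((∃ y, ζ x₂' y * lamFam hPd (P.L ^ k) c M0 s α x₂' y ≠ 0) ∨ (∃ y, ζ x₂ y * lamFam hPd (P.L ^ k) c M0 s α x₂ y ≠ 0)) ∨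
        ((∃ y, ζ x₁' y * lamFam hPd (P.L ^ k) c M0 s α x₁' y ≠ 0) ∨ (∃ y, ζ x₁ y * lamFam hPd (P.L ^ k) c M0 s α x₁ y ≠ 0))
    · have hP : ∃ p : Balaban1983to89.Site P 0, p ∈ Ω₀ ∧
          (∀ i, R₀ + R ≤ (boxCoord hPd (P.L ^ k) c p i : ℝ) ∧ (boxCoord hPd (P.L ^ k) c p i : ℝ) + (R₀ + R) ≤ (P.L ^ k * M0 i : ℕ) - 1) ∧
          (∃ y, ζ p y * lamFam hPd (P.L ^ k) c M0 s α p y ≠ 0) ∧ B5Ineq137Torus.T P 0 p x₁ ≤ (P.L : ℝ) ^ k + 1 := by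
        rcases hex with (hex | hex) | (hex | hex)
        · exact ⟨x₂', hx₂e, hdeep₂e, hex, by linarith only [hT2'1, hnear]⟩
        · exact ⟨x₂, hx₂, hdeep₂, hex, by linarith only [hT21, hnear]⟩
        · exact ⟨x₁', hx₁e, hdeep₁e, hex, by linarith only [hT1'1, hLk1]⟩
        · exact ⟨x₁, hx₁, hdeep₁, hex, by rw [B5Ineq137Torus.T_self]; positivity⟩
      obtain ⟨p, hp, hdp, hexp, hpx₁⟩ := hP
      have hx₁α : x₁ ∈ cubeFam hPd (P.L ^ k) c M0 s W α := nearα p hp hdp α hexp x₁ (by linarith only [hpx₁, hR, hρ])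
      have hρ₁ : ∀ v, v ∉ cubeFam hPd (P.L ^ k) c M0 s W α → ρ ≤ B5Ineq137Torus.T P 0 x₁ v :=
        depthαρ p hp hdp α hexp x₁ (by linarith only [hpx₁])
      have hDb₁ : ∀ v, v ∉ cubeFam hPd (P.L ^ k) c M0 s W α → Db ≤ B5Ineq137Torus.T P 0 x₁ v :=
        depthα p hp hdp α hexp x₁ (by linarith only [hpx₁])
      have hsrc : ∀ y, dD α y ≠ 0 →
          y ∈ cubeFam hPd (P.L ^ k) c M0 s W α ∧ ∀ v, v ∉ cubeFam hPd (P.L ^ k) c M0 s W α → R ≤ B5Ineq137Torus.T P 0 y v := by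
        intro y hy
        rcases hdD_act α y hy with (h1 | h1) | (h1 | h1)
        · exact srcα x₂' hx₂e hdeep₂e α y h1
        · exact srcα x₂ hx₂ hdeep₂ α y h1
        · exact srcα x₁' hx₁e hdeep₁e α y h1
        · exact srcα x₁ hx₁ hdeep₁ α y h1
      have hsuppα : ∀ y, y ∉ cubeFam hPd (P.L ^ k) c M0 s W α → dD α y = 0 := by
        intro y hy; by_contra hne'; exact hy (hsrc y hne').1
      have hDf : ∀ y, dD α y ≠ 0 → ∀ v, v ∉ cubeFam hPd (P.L ^ k) c M0 s W α → R ≤ B5Ineq137Torus.T P 0 y v :=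
        fun y hy v hv => (hsrc y hy).2 v hv
      obtain ⟨c', M', hM', hfit', hN', hcα⟩ := cubeFam_fits (hPd := hPd) (s := s) (W := W) hM0 hfit0 hN0 α
      have hsubΩ : (cubeT hPd (P.L ^ k) c' fun i => P.L ^ k * M' i) ⊆ Ω := hcα ▸ (cubeOf_subset α.1).trans hΩ
      rw [hcα] at hx₁α hρ₁ hDb₁ hsuppα hDf
      have key := H2 c' M' hM' hfit' hN' hsubΩ x₁ hx₁α hρ₁ (dD α) (Λ₂ * (((d : ℝ) + 1) * T12) * F) Dc Db R (hdD_le α) hsuppα hDc0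
        (fun y hy => hDc₁ y (hdD_supp α y hy)) hDb0 hDb₁ hR0 hDf
      rw [← hcα] at key
      rw [hsD_eq α, norm_mul, hEc]
      refine mul_le_mul_of_nonneg_left ?_ (inv_pos.mpr heps).le
      exact key.trans (mul_le_mul_of_nonneg_left (hXc (by positivity)) (by positivity))
    · simp only [not_or, not_exists, not_not] at hex
      simp only [hsDdef]
      rw [hds0 x₂ x₂' α (not_exists.2 fun y hy => hy (hex.1.1 y)) (not_exists.2 fun y hy => hy (hex.1.2 y)),
        hds0 x₁ x₁' α (not_exists.2 fun y hy => hy (hex.2.1 y)) (not_exists.2 fun y hy => hy (hex.2.2 y))]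
      simp only [mulVec_zero, Pi.zero_apply, mul_zero, sub_self, norm_zero]
      positivity
  have hzeroD : ∀ α, α ∉ (S x₂' ∪ S x₂) ∪ (S x₁' ∪ S x₁) → sD α = 0 := by
    intro α hα
    simp only [Finset.mem_union, not_or] at hα
    simp only [hsDdef]
    rw [hds0 x₂ x₂' α (fun ⟨y, hy⟩ => hα.1.1 (hS x₂' hdeep₂e0 α y hy)) (fun ⟨y, hy⟩ => hα.1.2 (hS x₂ hdeep₂0 α y hy)),
      hds0 x₁ x₁' α (fun ⟨y, hy⟩ => hα.2.1 (hS x₁' hdeep₁e0 α y hy)) (fun ⟨y, hy⟩ => hα.2.2 (hS x₁ hdeep₁0 α y hy))]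
    simp only [mulVec_zero, Pi.zero_apply, mul_zero, sub_self]
  have hsumD : ‖∑ α, sD α‖ ≤ 4 * m * (P.eps⁻¹ * BD) := by
    rw [← Finset.sum_subset (Finset.subset_univ ((S x₂' ∪ S x₂) ∪ (S x₁' ∪ S x₁))) (fun α _ hα => hzeroD α hα)]
    have hcardU : (((((S x₂' ∪ S x₂) ∪ (S x₁' ∪ S x₁)).card : ℕ)) : ℝ) ≤ 4 * m := by
      have h1 : ((((S x₂' ∪ S x₂) ∪ (S x₁' ∪ S x₁)).card : ℕ) : ℝ) ≤ (((S x₂' ∪ S x₂).card : ℕ) : ℝ) + (((S x₁' ∪ S x₁).card : ℕ) : ℝ) := by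
        exact_mod_cast Finset.card_union_le _ _
      have h2 : (((S x₂' ∪ S x₂).card : ℕ) : ℝ) ≤ ((S x₂').card : ℝ) + ((S x₂).card : ℝ) := by exact_mod_cast Finset.card_union_le _ _
      have h3 : (((S x₁' ∪ S x₁).card : ℕ) : ℝ) ≤ ((S x₁').card : ℝ) + ((S x₁).card : ℝ) := by exact_mod_cast Finset.card_union_le _ _
      linarith only [h1, h2, h3, hcard x₂', hcard x₂, hcard x₁', hcard x₁]
    calc ‖∑ α ∈ (S x₂' ∪ S x₂) ∪ (S x₁' ∪ S x₁), sD α‖ ≤ ∑ α ∈ (S x₂' ∪ S x₂) ∪ (S x₁' ∪ S x₁), ‖sD α‖ := norm_sum_le _ _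
      _ ≤ ∑ α ∈ (S x₂' ∪ S x₂) ∪ (S x₁' ∪ S x₁), P.eps⁻¹ * BD := Finset.sum_le_sum fun α _ => htermD α
      _ = ((S x₂' ∪ S x₂) ∪ (S x₁' ∪ S x₁)).card * (P.eps⁻¹ * BD) := by rw [Finset.sum_const, nsmul_eq_mul]
      _ ≤ 4 * m * (P.eps⁻¹ * BD) := mul_le_mul_of_nonneg_right hcardU (by positivity)
  /- THE TAIL PART: the sources `(ζ″ − 1)f`, `Δζ″·f`, `Δ²ζ″·f` live at torus distance `> R₁ − 1` from `x₁` or `x₂` -/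
  have hne1 : ∀ (p : Balaban1983to89.Site P 0) (y : Balaban1983to89.Site P 0), ζ (p.shift μ) y ≠ 1 →
      R₁ - 1 < B5Ineq137Torus.T P 0 p y := by
    intro p y hz
    have hgt : R₁ < B5Ineq137Torus.T P 0 (p.shift μ) y := lt_of_not_ge fun hle => hz (hζR₁ (p.shift μ) y hle)
    have h1 := abs_le.1 (abs_T_shift_sub_le p y μ)
    linarith
  have hne1' : ∀ (p : Balaban1983to89.Site P 0) (y : Balaban1983to89.Site P 0), ζ p y ≠ 1 → R₁ - 1 < B5Ineq137Torus.T P 0 p y := by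
    intro p y hz
    have hgt : R₁ < B5Ineq137Torus.T P 0 p y := lt_of_not_ge fun hle => hz (hζR₁ p y hle)
    linarith
  have hT11 : B5Ineq137Torus.T P 0 x₁ x₁ ≤ T12 := by rw [B5Ineq137Torus.T_self]; exact hT0
  have hT22 : B5Ineq137Torus.T P 0 x₂ x₂ ≤ T12 := by rw [B5Ineq137Torus.T_self]; exact hT0
  have hT12le : B5Ineq137Torus.T P 0 x₁ x₂ ≤ T12 := le_rfl
  have hT21le : B5Ineq137Torus.T P 0 x₂ x₁ ≤ T12 := hT21.le
  /- TERM A″: (H6) — [6] (1.9) on `Ω`, on the tail source `(ζ″(x₂',·) − 1)f` -/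
  set BtA : ℝ := P.spacing k * (c₀ * TE * (2 * F)) with hBtAdef
  have htermtA : w * ‖tA‖ ≤ BtA := by
    have hsq₁ : ∀ y, q x₂' y ≠ 0 → Dt ≤ B5Ineq137Torus.T P 0 x₁ y := fun y hy => by
      obtain ⟨hf, hT⟩ := T_gt_of_tail_ne_zero' hζR₁ x₂ μ hy
      exact htail x₁ hT11 hT21le y hf (Or.inr hT)
    have hsq₂ : ∀ y, q x₂' y ≠ 0 → Dt ≤ B5Ineq137Torus.T P 0 x₂ y := fun y hy => by
      obtain ⟨hf, hT⟩ := T_gt_of_tail_ne_zero' hζR₁ x₂ μ hy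
      exact htail x₂ hT12le hT22 y hf (Or.inr hT)
    have key := H6 x₁ x₂ μ hne12 hx₁Ω hx₂Ω hρΩ₁ hρΩ₂ (q x₂') (2 * F) Dt (fun y => norm_tail_le' hζabs x₂' hF y) hDt0 hsq₁ hsq₂
    rw [htAdef, hG₀def]
    exact key.trans (mul_le_mul_of_nonneg_left (hYc (by positivity)) hsp0.le)
  /- TERM B″: (H3) at `⟨x₁, x₁+e_μ⟩`, on `(ζ″(x₂',·) − ζ″(x₁',·))f` -/
  set dqB : Balaban1983to89.Site P 0 → ℂ := fun y => ((ζ x₂' y : ℂ) - (ζ x₁' y : ℂ)) * f y with hdqBdef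
  have hdqB : q x₂' - q x₁' = dqB := by funext y; simp only [hqdef, hdqBdef, Pi.sub_apply]; ring
  have htB_eq : tB = covD P.eps⁻¹ (cfg U) (G₀ *ᵥ dqB) ⟨x₁, μ⟩ := by rw [← hdqB, Matrix.mulVec_sub, covD_sub]
  have hdqB_le : ∀ y, ‖dqB y‖ ≤ K₁ / (R₀ - R₁) * (((d : ℝ) + 1) * T12) * F := by
    intro y
    have h1 := abs_zeta_shift_sub_le_of_hull hPd (n := P.L ^ k) (c := c) hζ1 z₁ z₂ μ y
    rw [hxz₁, hxz₂] at h1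
    simp only [hdqBdef]
    rw [norm_mul, ← Complex.ofReal_sub, Complex.norm_real, Real.norm_eq_abs]
    refine mul_le_mul (h1.trans ?_) (hF y) (norm_nonneg _) (by positivity)
    exact mul_le_mul_of_nonneg_left hl1 hK₁'
  have hdqB_supp : ∀ y, dqB y ≠ 0 → Dt ≤ B5Ineq137Torus.T P 0 x₁ y := by
    intro y hy
    have hf : f y ≠ 0 := right_ne_zero_of_mul hy
    refine htail x₁ hT11 hT21le y hf ?_
    by_contra hno
    rw [not_or] at hno
    have h2 : ζ x₂' y = 1 := by by_contra h; exact hno.2 (hne1 x₂ y h)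
    have h1 : ζ x₁' y = 1 := by by_contra h; exact hno.1 (hne1 x₁ y h)
    apply hy
    simp only [hdqBdef]; rw [h1, h2]; simp
  set BtB : ℝ := P.spacing k * (c₀ * TE * (K₁ / (R₀ - R₁) * (((d : ℝ) + 1) * T12) * F)) with hBtBdef
  have htermtB : ‖tB‖ ≤ BtB := by
    have key := H3 x₁ hx₁Ω hρΩ₁ μ dqB (K₁ / (R₀ - R₁) * (((d : ℝ) + 1) * T12) * F) Dt hdqB_le hDt0 hdqB_supp
    rw [htB_eq, hG₀def]
    exact key.trans (mul_le_mul_of_nonneg_left (hYc (by positivity)) hsp0.le)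
  /- TERM C″: the transported difference of the values of `G₀(Δ_μζ″(x₂,·)f)` between `x₁` and `x₂`, telescoped along the staircase, (H3) per bond -/
  have hdq_le : ∀ y, ‖dq x₂ x₂' y‖ ≤ K₁ / (R₀ - R₁) * F := fun y => norm_tailDiff_le' hK₁' (fun y => hζ1 x₂ y μ) hF y
  set BtC : ℝ := P.spacing k * (c₀ * TE * (K₁ / (R₀ - R₁) * F)) with hBtCdef
  have hBtC0 : 0 ≤ BtC := by rw [hBtCdef]; positivity
  have htermtC : ‖tC‖ ≤ BtC * (((d : ℝ) + 1) * T12) := by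
    have hbond : ∀ (w' : Balaban1983to89.Site P 0) (m' : Fin P.d), supDist x₁ w' ≤ supDist x₁ x₂ → supDist x₂ w' ≤ supDist x₁ x₂ →
        ‖covD P.eps⁻¹ (cfg U) (G₀ *ᵥ dq x₂ x₂') ⟨w', m'⟩‖ ≤ BtC := by
      intro w' m' hw1 hw2
      obtain ⟨hmemw, hdeepw, hTw⟩ := stairDeep w' hw2
      have hsq : ∀ y, dq x₂ x₂' y ≠ 0 → Dt ≤ B5Ineq137Torus.T P 0 w' y := fun y hy => by
        obtain ⟨hf, hT⟩ := T_gt_of_tailDiff_ne_zero' hζR₁ x₂ μ hy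
        exact htail w' (hTw₁ w' hw1) hTw y hf (Or.inr hT)
      have key := H3 w' (hΩ hmemw) (hΩdeep w' hdeepw) m' (dq x₂ x₂') (K₁ / (R₀ - R₁) * F) Dt hdq_le hDt0 hsq
      rw [hG₀def]
      exact key.trans (mul_le_mul_of_nonneg_left (hYc (by positivity)) hsp0.le)
    have htel := norm_stairHol_mul_sub_le_of_near U (inv_ne_zero heps.ne') (G₀ *ᵥ dq x₂ x₂') x₁ x₂ hBtC0 hbond
    rw [abs_inv, abs_of_pos heps, inv_inv, ← hT12N, hPdR] at htel
    have e1 : tC = Ec * (τ * (G₀ *ᵥ dq x₂ x₂') x₂ - (G₀ *ᵥ dq x₂ x₂') x₁) := by simp only [htCdef]; ring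
    rw [e1, norm_mul, hEc, hτdef]
    calc P.eps⁻¹ * ‖stairHol U x₁ x₂ * (G₀ *ᵥ dq x₂ x₂') x₂ - (G₀ *ᵥ dq x₂ x₂') x₁‖
        ≤ P.eps⁻¹ * (P.eps * BtC * (((d : ℝ) + 1) * T12)) := mul_le_mul_of_nonneg_left htel (inv_pos.mpr heps).le
      _ = BtC * (((d : ℝ) + 1) * T12) := by rw [← mul_assoc, ← mul_assoc P.eps⁻¹, inv_mul_cancel₀ heps.ne', one_mul]
  /- TERM D″: (H4) at `x₁`, on the second difference of `ζ″` times `f` -/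
  set dqD : Balaban1983to89.Site P 0 → ℂ := fun y =>
    (((ζ x₂' y - ζ x₂ y) - (ζ x₁' y - ζ x₁ y) : ℝ) : ℂ) * f y with hdqDdef
  have hdqD : dq x₂ x₂' - dq x₁ x₁' = dqD := by
    funext y; simp only [hdqdef, hdqDdef, Pi.sub_apply]; push_cast; ring
  have htD_eq : tD = Ec * (G₀ *ᵥ dqD) x₁ := by
    rw [← hdqD, Matrix.mulVec_sub]
    simp only [htDdef, Pi.sub_apply]; ring
  have hdqD_le : ∀ y, ‖dqD y‖ ≤ K₂ / (R₀ - R₁) ^ 2 * (((d : ℝ) + 1) * T12) * F := by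
    intro y
    have h1 := abs_zeta_bondDiff_sub_le_of_hull hPd (n := P.L ^ k) (c := c) hζ2 z₁ z₂ μ y
    rw [hxz₁, hxz₂] at h1
    simp only [hdqDdef]
    rw [norm_mul, Complex.norm_real, Real.norm_eq_abs]
    refine mul_le_mul (h1.trans ?_) (hF y) (norm_nonneg _) (by positivity)
    exact mul_le_mul_of_nonneg_left hl1 hK₂'
  have hdqD_supp : ∀ y, dqD y ≠ 0 → Dt ≤ B5Ineq137Torus.T P 0 x₁ y := by
    intro y hy
    have hf : f y ≠ 0 := right_ne_zero_of_mul hy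
    refine htail x₁ hT11 hT21le y hf ?_
    by_contra hno
    rw [not_or] at hno
    have h2' : ζ x₂' y = 1 := by by_contra h; exact hno.2 (hne1 x₂ y h)
    have h2 : ζ x₂ y = 1 := by by_contra h; exact hno.2 (hne1' x₂ y h)
    have h1' : ζ x₁' y = 1 := by by_contra h; exact hno.1 (hne1 x₁ y h)
    have h1 : ζ x₁ y = 1 := by by_contra h; exact hno.1 (hne1' x₁ y h)
    apply hy
    simp only [hdqDdef]; rw [h1, h2, h1', h2']; simp
  set BtD : ℝ := P.spacing k ^ 2 * (c₀ * TE * (K₂ / (R₀ - R₁) ^ 2 * (((d : ℝ) + 1) * T12) * F)) with hBtDdef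
  have htermtD : ‖tD‖ ≤ P.eps⁻¹ * BtD := by
    have key := H4 x₁ hx₁Ω hρΩ₁ dqD (K₂ / (R₀ - R₁) ^ 2 * (((d : ℝ) + 1) * T12) * F) Dt hdqD_le hDt0 hdqD_supp
    rw [htD_eq, norm_mul, hEc, hG₀def]
    refine mul_le_mul_of_nonneg_left ?_ (inv_pos.mpr heps).le
    exact key.trans (mul_le_mul_of_nonneg_left (hYc (by positivity)) (by positivity))
  /- ASSEMBLY -/
  have hscale : P.eps⁻¹ * P.spacing k ^ 2 = P.spacing k * (P.L : ℝ) ^ k := by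
    rw [Params.spacing]
    field_simp
  -- the Lipschitz moduli against the bracket: `L^k·Λ₁ ≤ Λ₀·br`, `(L^k)²·Λ₂ ≤ Λ₀₂·br²`, `L^k·K₁/(R₀−R₁) ≤ K₁·br`, `(L^k)²·K₂/(R₀−R₁)² ≤ K₂·br²`
  have hΛ₁le : (P.L : ℝ) ^ k * Λ₁ ≤ Λ₀ * br := by
    have h1 : Λ₁ ≤ Λ₀ * uv := by
      rw [hΛ₁def, huvdef, mul_add]
      refine add_le_add ?_ ?_
      · rw [div_eq_mul_inv]
        exact mul_le_mul_of_nonneg_right (le_max_left _ _) (inv_pos.mpr hgap').le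
      · have e : 3 * Real.pi * (d + 1 : ℕ) / (2 * s) = (3 * Real.pi * (d + 1 : ℕ) / 2) * (s : ℝ)⁻¹ := by
          field_simp
        rw [e]
        exact mul_le_mul_of_nonneg_right (le_max_right _ _) (inv_pos.mpr hsr).le
    calc (P.L : ℝ) ^ k * Λ₁ ≤ (P.L : ℝ) ^ k * (Λ₀ * uv) := mul_le_mul_of_nonneg_left h1 hLk.le
      _ = Λ₀ * ((P.L : ℝ) ^ k * uv) := by ring
      _ ≤ Λ₀ * br := mul_le_mul_of_nonneg_left hLuv hΛ₀0
  have hΛ₂le : ((P.L : ℝ) ^ k) ^ 2 * Λ₂ ≤ Λ₀₂ * br ^ 2 := by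
    have hu : 0 ≤ (R₀ - R₁)⁻¹ := (inv_pos.mpr hgap').le
    have hv : 0 ≤ (s : ℝ)⁻¹ := (inv_pos.mpr hsr).le
    have h1 : Λ₂ ≤ Λ₀₂ * uv ^ 2 := by
      rw [hΛ₂def, hΛ₀₂def, huvdef]
      have e1 : K₂ / (R₀ - R₁) ^ 2 = K₂ * ((R₀ - R₁)⁻¹) ^ 2 := by rw [div_eq_mul_inv, inv_pow]
      have e2 : 4 * Real.pi ^ 2 / (s : ℝ) ^ 2 = 4 * Real.pi ^ 2 * ((s : ℝ)⁻¹) ^ 2 := by rw [div_eq_mul_inv, inv_pow]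
      have e3 : 2 * (K₁ / (R₀ - R₁) * (3 * Real.pi * (d + 1 : ℕ) / (2 * s))) =
          3 * Real.pi * (d + 1 : ℕ) * K₁ * ((R₀ - R₁)⁻¹ * (s : ℝ)⁻¹) := by
        rw [div_eq_mul_inv, div_eq_mul_inv, mul_inv]
        ring
      rw [e1, e2, e3]
      have hq1 : ((R₀ - R₁)⁻¹) ^ 2 ≤ ((R₀ - R₁)⁻¹ + (s : ℝ)⁻¹) ^ 2 := pow_le_pow_left₀ hu (le_add_of_nonneg_right hv) 2
      have hq2 : ((s : ℝ)⁻¹) ^ 2 ≤ ((R₀ - R₁)⁻¹ + (s : ℝ)⁻¹) ^ 2 := pow_le_pow_left₀ hv (le_add_of_nonneg_left hu) 2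
      have hq3 : (R₀ - R₁)⁻¹ * (s : ℝ)⁻¹ ≤ ((R₀ - R₁)⁻¹ + (s : ℝ)⁻¹) ^ 2 := by
        have e : ((R₀ - R₁)⁻¹ + (s : ℝ)⁻¹) ^ 2 =
            (R₀ - R₁)⁻¹ * (s : ℝ)⁻¹ + (((R₀ - R₁)⁻¹) ^ 2 + (R₀ - R₁)⁻¹ * (s : ℝ)⁻¹ + ((s : ℝ)⁻¹) ^ 2) := by ring
        rw [e]
        exact le_add_of_nonneg_right (by positivity)
      have hπ : 0 ≤ 4 * Real.pi ^ 2 := by positivity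
      have hπK : 0 ≤ 3 * Real.pi * (d + 1 : ℕ) * K₁ := by positivity
      calc K₂ * ((R₀ - R₁)⁻¹) ^ 2 + 4 * Real.pi ^ 2 * ((s : ℝ)⁻¹) ^ 2 + 3 * Real.pi * (d + 1 : ℕ) * K₁ * ((R₀ - R₁)⁻¹ * (s : ℝ)⁻¹)
          ≤ K₂ * ((R₀ - R₁)⁻¹ + (s : ℝ)⁻¹) ^ 2 + 4 * Real.pi ^ 2 * ((R₀ - R₁)⁻¹ + (s : ℝ)⁻¹) ^ 2 +
            3 * Real.pi * (d + 1 : ℕ) * K₁ * ((R₀ - R₁)⁻¹ + (s : ℝ)⁻¹) ^ 2 :=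
            add_le_add (add_le_add (mul_le_mul_of_nonneg_left hq1 hK₂) (mul_le_mul_of_nonneg_left hq2 hπ))
              (mul_le_mul_of_nonneg_left hq3 hπK)
        _ = (K₂ + 4 * Real.pi ^ 2 + 3 * Real.pi * (d + 1 : ℕ) * K₁) * ((R₀ - R₁)⁻¹ + (s : ℝ)⁻¹) ^ 2 := by ring
    calc ((P.L : ℝ) ^ k) ^ 2 * Λ₂ ≤ ((P.L : ℝ) ^ k) ^ 2 * (Λ₀₂ * uv ^ 2) := mul_le_mul_of_nonneg_left h1 (by positivity)
      _ = Λ₀₂ * ((P.L : ℝ) ^ k * uv) ^ 2 := by ring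
      _ ≤ Λ₀₂ * br ^ 2 := mul_le_mul_of_nonneg_left (pow_le_pow_left₀ (by positivity) hLuv 2) hΛ₀₂0
  have hK₁le : (P.L : ℝ) ^ k * (K₁ / (R₀ - R₁)) ≤ K₁ * br := by
    calc (P.L : ℝ) ^ k * (K₁ / (R₀ - R₁)) = K₁ * ((P.L : ℝ) ^ k * (R₀ - R₁)⁻¹) := by rw [div_eq_mul_inv]; ring
      _ ≤ K₁ * br := mul_le_mul_of_nonneg_left hLR01 hK₁
  have hK₂le : ((P.L : ℝ) ^ k) ^ 2 * (K₂ / (R₀ - R₁) ^ 2) ≤ K₂ * br ^ 2 := by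
    have h1 : ((P.L : ℝ) ^ k * (R₀ - R₁)⁻¹) ^ 2 ≤ br ^ 2 := pow_le_pow_left₀ (by positivity) hLR01 2
    calc ((P.L : ℝ) ^ k) ^ 2 * (K₂ / (R₀ - R₁) ^ 2) = K₂ * ((P.L : ℝ) ^ k * (R₀ - R₁)⁻¹) ^ 2 := by
          rw [div_eq_mul_inv, ← inv_pow]; ring
      _ ≤ K₂ * br ^ 2 := mul_le_mul_of_nonneg_left h1 hK₂
  -- the eight terms in the common shapes `spacing·(κ·m·br²·GE·F)` (cube part) and `spacing·(κ·br²·TE·F)` (tail part)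
  have hPF : 0 ≤ P.spacing k * F := mul_nonneg hsp0.le hF0
  have hA : w * ‖∑ α, sA α‖ ≤ P.spacing k * (c₀ * m * br ^ 2 * GE * F) := by
    refine hsumA.trans ?_
    rw [hBAdef]
    calc m * (P.spacing k * (c₀ * GE * F)) = P.spacing k * (c₀ * m * 1 * GE * F) := by ring
      _ ≤ P.spacing k * (c₀ * m * br ^ 2 * GE * F) := by
          refine mul_le_mul_of_nonneg_left ?_ hsp0.le
          exact mul_le_mul_of_nonneg_right (mul_le_mul_of_nonneg_right (mul_le_mul_of_nonneg_left hbr21 (by positivity)) hGE0.le) hF0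
  have hB : w * ‖∑ α, sB α‖ ≤ P.spacing k * ((2 * ((d : ℝ) + 1) * c₀ * Λ₀) * m * br ^ 2 * GE * F) := by
    have h1 : w * ‖∑ α, sB α‖ ≤ w * (2 * m * BB) := mul_le_mul_of_nonneg_left hsumB hw0
    refine h1.trans ?_
    have e : w * (2 * m * BB) = (w * T12) * Λ₁ * (P.spacing k * (2 * ((d : ℝ) + 1) * c₀ * m * GE * F)) := by
      rw [hBBdef]; ring
    rw [e]
    have h2 : (w * T12) * Λ₁ ≤ Λ₀ * br := le_trans (mul_le_mul_of_nonneg_right hwT hΛ₁0) hΛ₁le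
    calc (w * T12) * Λ₁ * (P.spacing k * (2 * ((d : ℝ) + 1) * c₀ * m * GE * F))
        ≤ (Λ₀ * br) * (P.spacing k * (2 * ((d : ℝ) + 1) * c₀ * m * GE * F)) := mul_le_mul_of_nonneg_right h2 (by positivity)
      _ = P.spacing k * ((2 * ((d : ℝ) + 1) * c₀ * Λ₀) * m * br * GE * F) := by ring
      _ ≤ P.spacing k * ((2 * ((d : ℝ) + 1) * c₀ * Λ₀) * m * br ^ 2 * GE * F) := by
          refine mul_le_mul_of_nonneg_left ?_ hsp0.le
          exact mul_le_mul_of_nonneg_right (mul_le_mul_of_nonneg_right (mul_le_mul_of_nonneg_left hbr2 (by positivity)) hGE0.le) hF0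
  have hC : w * ‖∑ α, sC α‖ ≤ P.spacing k * ((2 * ((d : ℝ) + 1) * c₀ * Λ₀) * m * br ^ 2 * GE * F) := by
    have h1 : w * ‖∑ α, sC α‖ ≤ w * (2 * m * (BC * (((d : ℝ) + 1) * T12))) := mul_le_mul_of_nonneg_left hsumC hw0
    refine h1.trans ?_
    have e : w * (2 * m * (BC * (((d : ℝ) + 1) * T12))) = (w * T12) * Λ₁ * (P.spacing k * (2 * ((d : ℝ) + 1) * c₀ * m * GE * F)) := by
      rw [hBCdef]; ring
    rw [e]
    have h2 : (w * T12) * Λ₁ ≤ Λ₀ * br := le_trans (mul_le_mul_of_nonneg_right hwT hΛ₁0) hΛ₁le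
    calc (w * T12) * Λ₁ * (P.spacing k * (2 * ((d : ℝ) + 1) * c₀ * m * GE * F))
        ≤ (Λ₀ * br) * (P.spacing k * (2 * ((d : ℝ) + 1) * c₀ * m * GE * F)) := mul_le_mul_of_nonneg_right h2 (by positivity)
      _ = P.spacing k * ((2 * ((d : ℝ) + 1) * c₀ * Λ₀) * m * br * GE * F) := by ring
      _ ≤ P.spacing k * ((2 * ((d : ℝ) + 1) * c₀ * Λ₀) * m * br ^ 2 * GE * F) := by
          refine mul_le_mul_of_nonneg_left ?_ hsp0.le
          exact mul_le_mul_of_nonneg_right (mul_le_mul_of_nonneg_right (mul_le_mul_of_nonneg_left hbr2 (by positivity)) hGE0.le) hF0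
  have hDt : w * ‖∑ α, sD α‖ ≤ P.spacing k * ((4 * ((d : ℝ) + 1) * c₀ * Λ₀₂) * m * br ^ 2 * GE * F) := by
    have h1 : w * ‖∑ α, sD α‖ ≤ w * (4 * m * (P.eps⁻¹ * BD)) := mul_le_mul_of_nonneg_left hsumD hw0
    refine h1.trans ?_
    have e : w * (4 * m * (P.eps⁻¹ * BD)) =
        (w * T12) * ((P.eps⁻¹ * P.spacing k ^ 2) * (4 * ((d : ℝ) + 1) * c₀ * m * Λ₂ * GE * F)) := by
      rw [hBDdef]; ring
    rw [e, hscale]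
    have e2 : (w * T12) * (P.spacing k * (P.L : ℝ) ^ k * (4 * ((d : ℝ) + 1) * c₀ * m * Λ₂ * GE * F)) =
        ((w * T12) * ((P.L : ℝ) ^ k * Λ₂)) * (P.spacing k * (4 * ((d : ℝ) + 1) * c₀ * m * GE * F)) := by ring
    rw [e2]
    have h2 : (w * T12) * ((P.L : ℝ) ^ k * Λ₂) ≤ Λ₀₂ * br ^ 2 := by
      calc (w * T12) * ((P.L : ℝ) ^ k * Λ₂) ≤ (P.L : ℝ) ^ k * ((P.L : ℝ) ^ k * Λ₂) := mul_le_mul_of_nonneg_right hwT (by positivity)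
        _ = ((P.L : ℝ) ^ k) ^ 2 * Λ₂ := by ring
        _ ≤ Λ₀₂ * br ^ 2 := hΛ₂le
    calc ((w * T12) * ((P.L : ℝ) ^ k * Λ₂)) * (P.spacing k * (4 * ((d : ℝ) + 1) * c₀ * m * GE * F))
        ≤ (Λ₀₂ * br ^ 2) * (P.spacing k * (4 * ((d : ℝ) + 1) * c₀ * m * GE * F)) := mul_le_mul_of_nonneg_right h2 (by positivity)
      _ = P.spacing k * ((4 * ((d : ℝ) + 1) * c₀ * Λ₀₂) * m * br ^ 2 * GE * F) := by ring
  have htA : w * ‖tA‖ ≤ P.spacing k * ((2 * c₀) * br ^ 2 * TE * F) := by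
    refine htermtA.trans ?_
    rw [hBtAdef]
    calc P.spacing k * (c₀ * TE * (2 * F)) = P.spacing k * ((2 * c₀) * 1 * TE * F) := by ring
      _ ≤ P.spacing k * ((2 * c₀) * br ^ 2 * TE * F) := by
          refine mul_le_mul_of_nonneg_left ?_ hsp0.le
          exact mul_le_mul_of_nonneg_right (mul_le_mul_of_nonneg_right (mul_le_mul_of_nonneg_left hbr21 (by positivity)) hTE0.le) hF0
  have htB : w * ‖tB‖ ≤ P.spacing k * ((((d : ℝ) + 1) * c₀ * K₁) * br ^ 2 * TE * F) := by
    have h1 : w * ‖tB‖ ≤ w * BtB := mul_le_mul_of_nonneg_left htermtB hw0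
    refine h1.trans ?_
    have e : w * BtB = (w * T12) * (K₁ / (R₀ - R₁)) * (P.spacing k * (((d : ℝ) + 1) * c₀ * TE * F)) := by rw [hBtBdef]; ring
    rw [e]
    have h2 : (w * T12) * (K₁ / (R₀ - R₁)) ≤ K₁ * br := le_trans (mul_le_mul_of_nonneg_right hwT hK₁') hK₁le
    calc (w * T12) * (K₁ / (R₀ - R₁)) * (P.spacing k * (((d : ℝ) + 1) * c₀ * TE * F))
        ≤ (K₁ * br) * (P.spacing k * (((d : ℝ) + 1) * c₀ * TE * F)) := mul_le_mul_of_nonneg_right h2 (by positivity)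
      _ = P.spacing k * ((((d : ℝ) + 1) * c₀ * K₁) * br * TE * F) := by ring
      _ ≤ P.spacing k * ((((d : ℝ) + 1) * c₀ * K₁) * br ^ 2 * TE * F) := by
          refine mul_le_mul_of_nonneg_left ?_ hsp0.le
          exact mul_le_mul_of_nonneg_right (mul_le_mul_of_nonneg_right (mul_le_mul_of_nonneg_left hbr2 (by positivity)) hTE0.le) hF0
  have htC : w * ‖tC‖ ≤ P.spacing k * ((((d : ℝ) + 1) * c₀ * K₁) * br ^ 2 * TE * F) := by
    have h1 : w * ‖tC‖ ≤ w * (BtC * (((d : ℝ) + 1) * T12)) := mul_le_mul_of_nonneg_left htermtC hw0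
    refine h1.trans ?_
    have e : w * (BtC * (((d : ℝ) + 1) * T12)) = (w * T12) * (K₁ / (R₀ - R₁)) * (P.spacing k * (((d : ℝ) + 1) * c₀ * TE * F)) := by
      rw [hBtCdef]; ring
    rw [e]
    have h2 : (w * T12) * (K₁ / (R₀ - R₁)) ≤ K₁ * br := le_trans (mul_le_mul_of_nonneg_right hwT hK₁') hK₁le
    calc (w * T12) * (K₁ / (R₀ - R₁)) * (P.spacing k * (((d : ℝ) + 1) * c₀ * TE * F))
        ≤ (K₁ * br) * (P.spacing k * (((d : ℝ) + 1) * c₀ * TE * F)) := mul_le_mul_of_nonneg_right h2 (by positivity)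
      _ = P.spacing k * ((((d : ℝ) + 1) * c₀ * K₁) * br * TE * F) := by ring
      _ ≤ P.spacing k * ((((d : ℝ) + 1) * c₀ * K₁) * br ^ 2 * TE * F) := by
          refine mul_le_mul_of_nonneg_left ?_ hsp0.le
          exact mul_le_mul_of_nonneg_right (mul_le_mul_of_nonneg_right (mul_le_mul_of_nonneg_left hbr2 (by positivity)) hTE0.le) hF0
  have htD : w * ‖tD‖ ≤ P.spacing k * ((((d : ℝ) + 1) * c₀ * K₂) * br ^ 2 * TE * F) := by
    have h1 : w * ‖tD‖ ≤ w * (P.eps⁻¹ * BtD) := mul_le_mul_of_nonneg_left htermtD hw0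
    refine h1.trans ?_
    have e : w * (P.eps⁻¹ * BtD) =
        (w * T12) * ((P.eps⁻¹ * P.spacing k ^ 2) * (((d : ℝ) + 1) * c₀ * (K₂ / (R₀ - R₁) ^ 2) * TE * F)) := by
      rw [hBtDdef]; ring
    rw [e, hscale]
    have e2 : (w * T12) * (P.spacing k * (P.L : ℝ) ^ k * (((d : ℝ) + 1) * c₀ * (K₂ / (R₀ - R₁) ^ 2) * TE * F)) =
        ((w * T12) * ((P.L : ℝ) ^ k * (K₂ / (R₀ - R₁) ^ 2))) * (P.spacing k * (((d : ℝ) + 1) * c₀ * TE * F)) := by ring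
    rw [e2]
    have h2 : (w * T12) * ((P.L : ℝ) ^ k * (K₂ / (R₀ - R₁) ^ 2)) ≤ K₂ * br ^ 2 := by
      calc (w * T12) * ((P.L : ℝ) ^ k * (K₂ / (R₀ - R₁) ^ 2)) ≤ (P.L : ℝ) ^ k * ((P.L : ℝ) ^ k * (K₂ / (R₀ - R₁) ^ 2)) :=
            mul_le_mul_of_nonneg_right hwT (by positivity)
        _ = ((P.L : ℝ) ^ k) ^ 2 * (K₂ / (R₀ - R₁) ^ 2) := by ring
        _ ≤ K₂ * br ^ 2 := hK₂le
    calc ((w * T12) * ((P.L : ℝ) ^ k * (K₂ / (R₀ - R₁) ^ 2))) * (P.spacing k * (((d : ℝ) + 1) * c₀ * TE * F))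
        ≤ (K₂ * br ^ 2) * (P.spacing k * (((d : ℝ) + 1) * c₀ * TE * F)) := mul_le_mul_of_nonneg_right h2 (by positivity)
      _ = P.spacing k * ((((d : ℝ) + 1) * c₀ * K₂) * br ^ 2 * TE * F) := by ring
  -- conclusion
  have hsplit : ‖((∑ α, sA α + ∑ α, sB α) + (∑ α, sC α + ∑ α, sD α)) + ((tA + tB) + (tC + tD))‖ ≤
      (‖∑ α, sA α‖ + ‖∑ α, sB α‖ + (‖∑ α, sC α‖ + ‖∑ α, sD α‖)) + ((‖tA‖ + ‖tB‖) + (‖tC‖ + ‖tD‖)) :=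
    (norm_add_le _ _).trans (add_le_add ((norm_add_le _ _).trans (add_le_add (norm_add_le _ _) (norm_add_le _ _)))
      ((norm_add_le _ _).trans (add_le_add (norm_add_le _ _) (norm_add_le _ _))))
  have hκc : c₀ + (2 * ((d : ℝ) + 1) * c₀ * Λ₀) + (2 * ((d : ℝ) + 1) * c₀ * Λ₀) + (4 * ((d : ℝ) + 1) * c₀ * Λ₀₂) = κc := by
    rw [hκcdef]; ring
  have hκt : (2 * c₀) + (((d : ℝ) + 1) * c₀ * K₁) + (((d : ℝ) + 1) * c₀ * K₁) + (((d : ℝ) + 1) * c₀ * K₂) = κt := by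
    rw [hκtdef]; ring
  have hGEle : κc * m * br ^ 2 * GE * F ≤ C * eδ * br ^ 2 * (m * E2R) * E * F := by
    have h1 : κc ≤ C := by rw [hCdef]; linarith only [hκt0, hCf0.le]
    calc κc * m * br ^ 2 * GE * F = κc * (eδ * br ^ 2 * (m * E2R) * E * F) := by rw [hGEdef]; ring
      _ ≤ C * (eδ * br ^ 2 * (m * E2R) * E * F) := mul_le_mul_of_nonneg_right h1 (by positivity)
      _ = C * eδ * br ^ 2 * (m * E2R) * E * F := by ring
  have hTEle : κt * br ^ 2 * TE * F ≤ C * eδ * br ^ 2 * ER1 * E * F := by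
    have h1 : κt ≤ C := by rw [hCdef]; linarith only [hκc0, hCf0.le]
    calc κt * br ^ 2 * TE * F = κt * (eδ * br ^ 2 * ER1 * E * F) := by rw [hTEdef]; ring
      _ ≤ C * (eδ * br ^ 2 * ER1 * E * F) := mul_le_mul_of_nonneg_right h1 (by positivity)
      _ = C * eδ * br ^ 2 * ER1 * E * F := by ring
  calc w * ‖τ * (∑ α, (covD P.eps⁻¹ (cfg U) (G α *ᵥ gs x₂' α) ⟨x₂, μ⟩ - covD P.eps⁻¹ (cfg U) (G₀ *ᵥ gs x₂' α) ⟨x₂, μ⟩) +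
          ∑ α, Ec * ((G α *ᵥ ds x₂ x₂' α) x₂ - (G₀ *ᵥ ds x₂ x₂' α) x₂) +
          covD P.eps⁻¹ (cfg U) (G₀ *ᵥ q x₂') ⟨x₂, μ⟩ + Ec * (G₀ *ᵥ dq x₂ x₂') x₂) -
        (∑ α, (covD P.eps⁻¹ (cfg U) (G α *ᵥ gs x₁' α) ⟨x₁, μ⟩ - covD P.eps⁻¹ (cfg U) (G₀ *ᵥ gs x₁' α) ⟨x₁, μ⟩) +
          ∑ α, Ec * ((G α *ᵥ ds x₁ x₁' α) x₁ - (G₀ *ᵥ ds x₁ x₁' α) x₁) +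
          covD P.eps⁻¹ (cfg U) (G₀ *ᵥ q x₁') ⟨x₁, μ⟩ + Ec * (G₀ *ᵥ dq x₁ x₁') x₁)‖
      = w * ‖((∑ α, sA α + ∑ α, sB α) + (∑ α, sC α + ∑ α, sD α)) + ((tA + tB) + (tC + tD))‖ := by rw [hdecomp]
    _ ≤ w * ((‖∑ α, sA α‖ + ‖∑ α, sB α‖ + (‖∑ α, sC α‖ + ‖∑ α, sD α‖)) + ((‖tA‖ + ‖tB‖) + (‖tC‖ + ‖tD‖))) :=
        mul_le_mul_of_nonneg_left hsplit hw0
    _ = (w * ‖∑ α, sA α‖ + w * ‖∑ α, sB α‖ + (w * ‖∑ α, sC α‖ + w * ‖∑ α, sD α‖)) +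
          ((w * ‖tA‖ + w * ‖tB‖) + (w * ‖tC‖ + w * ‖tD‖)) := by ring
    _ ≤ (P.spacing k * (c₀ * m * br ^ 2 * GE * F) + P.spacing k * ((2 * ((d : ℝ) + 1) * c₀ * Λ₀) * m * br ^ 2 * GE * F) +
          (P.spacing k * ((2 * ((d : ℝ) + 1) * c₀ * Λ₀) * m * br ^ 2 * GE * F) +
            P.spacing k * ((4 * ((d : ℝ) + 1) * c₀ * Λ₀₂) * m * br ^ 2 * GE * F))) +
          ((P.spacing k * ((2 * c₀) * br ^ 2 * TE * F) + P.spacing k * ((((d : ℝ) + 1) * c₀ * K₁) * br ^ 2 * TE * F)) +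
            (P.spacing k * ((((d : ℝ) + 1) * c₀ * K₁) * br ^ 2 * TE * F) + P.spacing k * ((((d : ℝ) + 1) * c₀ * K₂) * br ^ 2 * TE * F))) :=
        add_le_add (add_le_add (add_le_add hA hB) (add_le_add hC hDt)) (add_le_add (add_le_add htA htB) (add_le_add htC htD))
    _ = P.spacing k * ((c₀ + (2 * ((d : ℝ) + 1) * c₀ * Λ₀) + (2 * ((d : ℝ) + 1) * c₀ * Λ₀) + (4 * ((d : ℝ) + 1) * c₀ * Λ₀₂)) * m * br ^ 2 * GE * F) +
          P.spacing k * (((2 * c₀) + (((d : ℝ) + 1) * c₀ * K₁) + (((d : ℝ) + 1) * c₀ * K₁) + (((d : ℝ) + 1) * c₀ * K₂)) * br ^ 2 * TE * F) := by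
        ring
    _ = P.spacing k * (κc * m * br ^ 2 * GE * F) + P.spacing k * (κt * br ^ 2 * TE * F) := by rw [hκc, hκt]
    _ ≤ P.spacing k * (C * eδ * br ^ 2 * (m * E2R) * E * F) + P.spacing k * (C * eδ * br ^ 2 * ER1 * E * F) :=
        add_le_add (mul_le_mul_of_nonneg_left hGEle hsp0.le) (mul_le_mul_of_nonneg_left hTEle hsp0.le)
    _ = P.spacing k * (C * eδ * br ^ 2 * (m * E2R + ER1) * E * F) := by ring

end DerivHolder

/-! ## §2 The member for the smooth product cut-off `ζ″ = ζ^Π(R₁, R₀)` of (2.29) -/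

section ZetaPiMember

open BIJ88LocDeriv230ZetaPiFlatTorus (zetaPi_zero_eq_zero_of_le zetaPi_zero_eq_one_of_le abs_zetaPi_zero_le_one abs_zetaPi_zero_shift_sub_le
  abs_zetaPi_zero_secondDiff_le)
open BIJ88HkLocHolderTorus (zetaPi secondDiffConst)
open Literature.Analysis.Calculus (exists_abs_deriv_and_deriv_deriv_smoothTransition_le)

set_option maxHeartbeats 800000 in
/-- **THE HÖLDER MEMBER OF ORDER `1 + θ` OF (2.31) FOR A GENERAL REGION `Ω ⊇ Ω₀` AT r18's SMOOTH PRODUCT CUT-OFF `ζ″ = ζ^Π(R₁, R₀)` OF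
(2.29), FROM THE SIX [6]-INPUTS AS HYPOTHESES** (print p. 263: *"ζ_k(x₁, x₂) is a smooth function of x₁ − x₂"*, (2.29), and *"Bounds
analogous to (2.30), (2.31) hold for covariant derivatives and Hölder derivatives of G_{k,loc}(u) of order less than two"*): §1 with
`ζ″ := zetaPi R₁ R₀ 0`, hypothesis-free in the cut-off for `1 ≤ R₁ < R₀ ≤ (|T^{(0)}| − 3)/2` (`|ζ^Π| ≤ 1`, `= 0` beyond `R₀`, `= 1` within
`R₁`, first differences `≤ C_σ/(R₀ − R₁)`, mixed second differences `≤ (C_σ² + C_σ)/(R₀ − R₁)²` from the universal profile bound `C_σ` of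
`Literature.Analysis.Calculus.exists_abs_deriv_and_deriv_deriv_smoothTransition_le`); the constant `C` depends on `(d, c₀, θ)` and `C_σ`
only.
[cite: BalabanImbrieJaffe1988, (2.29), (2.31) p.263] [cite: Balaban1983RegularityDecay, Theorem p.573 (1.9), (1.11)–(1.12)] -/
theorem derivHolder231_region_of_inputs_zetaPi (d : ℕ) {c₀ : ℝ} (hc₀ : 0 ≤ c₀) {θ : ℝ} (hθ0 : 0 ≤ θ) (hθ1 : θ < 1) :
    ∃ C : ℝ, 0 < C ∧ ∀ (P : Params) (hPd : P.d = d + 1) (a : ℝ) (k : ℕ), 1 ≤ k → k ≤ P.K →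
      ∀ (U : GaugeField P 0 U1) (Ω : Finset (Balaban1983to89.Site P 0)) (δ₀ ρ : ℝ), 0 < δ₀ → 0 ≤ ρ →
      -- (H1) the (1.11)–(1.12) covariant-derivative closeness member for the fitting no-wrap cubes `□ ⊆ Ω`
      (∀ (c' M' : Fin (d + 1) → ℕ), (∀ i, 1 ≤ M' i) → (∀ i, c' i * P.L ^ k + P.L ^ k * M' i ≤ P.sitesPerDir 0) →
          (∀ i, P.L ^ k * M' i < P.sitesPerDir 0) → (cubeT hPd (P.L ^ k) c' fun i => P.L ^ k * M' i) ⊆ Ω →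
        ∀ (x : Balaban1983to89.Site P 0) (μ : Fin P.d), x ∈ (cubeT hPd (P.L ^ k) c' fun i => P.L ^ k * M' i) →
          x.shift μ ∈ (cubeT hPd (P.L ^ k) c' fun i => P.L ^ k * M' i) →
          (∀ w, w ∉ (cubeT hPd (P.L ^ k) c' fun i => P.L ^ k * M' i) → ρ ≤ B5Ineq137Torus.T P 0 x w) →
        ∀ (g : Balaban1983to89.Site P 0 → ℂ) (F D Db Df : ℝ), (∀ y, ‖g y‖ ≤ F) →
          (∀ y, y ∉ (cubeT hPd (P.L ^ k) c' fun i => P.L ^ k * M' i) → g y = 0) →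
          0 ≤ D → (∀ y, g y ≠ 0 → D ≤ B5Ineq137Torus.T P 0 x y) →
          0 ≤ Db → (∀ w, w ∉ (cubeT hPd (P.L ^ k) c' fun i => P.L ^ k * M' i) → Db ≤ B5Ineq137Torus.T P 0 x w) →
          0 ≤ Df → (∀ y, g y ≠ 0 → ∀ w, w ∉ (cubeT hPd (P.L ^ k) c' fun i => P.L ^ k * M' i) → Df ≤ B5Ineq137Torus.T P 0 y w) →
          ‖covD P.eps⁻¹ (cfg U) (gBox (B1RG242Torus.α P a k * (P.L : ℝ) ^ (k * P.d)) P.eps⁻¹ U k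
                  (cubeT hPd (P.L ^ k) c' fun i => P.L ^ k * M' i) *ᵥ g) ⟨x, μ⟩ -
              covD P.eps⁻¹ (cfg U) (gBox (B1RG242Torus.α P a k * (P.L : ℝ) ^ (k * P.d)) P.eps⁻¹ U k Ω *ᵥ g) ⟨x, μ⟩‖ ≤
            P.spacing k * (c₀ * Real.exp (-(δ₀ * (((P.L : ℝ) ^ k)⁻¹ * D))) * Real.exp (-(δ₀ * (((P.L : ℝ) ^ k)⁻¹ * (Db + Df)))) * F)) →
      -- (H2) the (1.11)–(1.12) value closeness member for the same cubes and rows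
      (∀ (c' M' : Fin (d + 1) → ℕ), (∀ i, 1 ≤ M' i) → (∀ i, c' i * P.L ^ k + P.L ^ k * M' i ≤ P.sitesPerDir 0) →
          (∀ i, P.L ^ k * M' i < P.sitesPerDir 0) → (cubeT hPd (P.L ^ k) c' fun i => P.L ^ k * M' i) ⊆ Ω →
        ∀ (x : Balaban1983to89.Site P 0), x ∈ (cubeT hPd (P.L ^ k) c' fun i => P.L ^ k * M' i) →
          (∀ w, w ∉ (cubeT hPd (P.L ^ k) c' fun i => P.L ^ k * M' i) → ρ ≤ B5Ineq137Torus.T P 0 x w) →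
        ∀ (g : Balaban1983to89.Site P 0 → ℂ) (F D Db Df : ℝ), (∀ y, ‖g y‖ ≤ F) →
          (∀ y, y ∉ (cubeT hPd (P.L ^ k) c' fun i => P.L ^ k * M' i) → g y = 0) →
          0 ≤ D → (∀ y, g y ≠ 0 → D ≤ B5Ineq137Torus.T P 0 x y) →
          0 ≤ Db → (∀ w, w ∉ (cubeT hPd (P.L ^ k) c' fun i => P.L ^ k * M' i) → Db ≤ B5Ineq137Torus.T P 0 x w) →
          0 ≤ Df → (∀ y, g y ≠ 0 → ∀ w, w ∉ (cubeT hPd (P.L ^ k) c' fun i => P.L ^ k * M' i) → Df ≤ B5Ineq137Torus.T P 0 y w) →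
          ‖(gBox (B1RG242Torus.α P a k * (P.L : ℝ) ^ (k * P.d)) P.eps⁻¹ U k (cubeT hPd (P.L ^ k) c' fun i => P.L ^ k * M' i) *ᵥ g) x -
              (gBox (B1RG242Torus.α P a k * (P.L : ℝ) ^ (k * P.d)) P.eps⁻¹ U k Ω *ᵥ g) x‖ ≤
            P.spacing k ^ 2 * (c₀ * Real.exp (-(δ₀ * (((P.L : ℝ) ^ k)⁻¹ * D))) * Real.exp (-(δ₀ * (((P.L : ℝ) ^ k)⁻¹ * (Db + Df)))) * F)) →
      -- (H3) the (1.10) covariant-derivative member of `G_k(Ω,u)` at the `ρ`-deep rows of `Ω`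
      (∀ (x : Balaban1983to89.Site P 0), x ∈ Ω → (∀ w, w ∉ Ω → ρ ≤ B5Ineq137Torus.T P 0 x w) →
        ∀ (μ : Fin P.d) (g : Balaban1983to89.Site P 0 → ℂ) (F D : ℝ), (∀ y, ‖g y‖ ≤ F) → 0 ≤ D →
          (∀ y, g y ≠ 0 → D ≤ B5Ineq137Torus.T P 0 x y) →
          ‖covD P.eps⁻¹ (cfg U) (gBox (B1RG242Torus.α P a k * (P.L : ℝ) ^ (k * P.d)) P.eps⁻¹ U k Ω *ᵥ g) ⟨x, μ⟩‖ ≤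
            P.spacing k * (c₀ * Real.exp (-(δ₀ * (((P.L : ℝ) ^ k)⁻¹ * D))) * F)) →
      -- (H4) the (1.10) value member of `G_k(Ω,u)` at the `ρ`-deep rows of `Ω`
      (∀ (x : Balaban1983to89.Site P 0), x ∈ Ω → (∀ w, w ∉ Ω → ρ ≤ B5Ineq137Torus.T P 0 x w) →
        ∀ (g : Balaban1983to89.Site P 0 → ℂ) (F D : ℝ), (∀ y, ‖g y‖ ≤ F) → 0 ≤ D →
          (∀ y, g y ≠ 0 → D ≤ B5Ineq137Torus.T P 0 x y) →
          ‖(gBox (B1RG242Torus.α P a k * (P.L : ℝ) ^ (k * P.d)) P.eps⁻¹ U k Ω *ᵥ g) x‖ ≤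
            P.spacing k ^ 2 * (c₀ * Real.exp (-(δ₀ * (((P.L : ℝ) ^ k)⁻¹ * D))) * F)) →
      -- (H5) the (1.11)–(1.12) Hölder-of-`D_u` closeness member for the fitting no-wrap cubes `□ ⊆ Ω` at pairs of distinct `ρ`-deep rows
      (∀ (c' M' : Fin (d + 1) → ℕ), (∀ i, 1 ≤ M' i) → (∀ i, c' i * P.L ^ k + P.L ^ k * M' i ≤ P.sitesPerDir 0) →
          (∀ i, P.L ^ k * M' i < P.sitesPerDir 0) → (cubeT hPd (P.L ^ k) c' fun i => P.L ^ k * M' i) ⊆ Ω →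
        ∀ (x₁ x₂ : Balaban1983to89.Site P 0) (μ : Fin P.d), x₁ ≠ x₂ → x₁ ∈ (cubeT hPd (P.L ^ k) c' fun i => P.L ^ k * M' i) → x₂ ∈ (cubeT hPd (P.L ^ k) c' fun i => P.L ^ k * M' i) →
          (∀ w, w ∉ (cubeT hPd (P.L ^ k) c' fun i => P.L ^ k * M' i) → ρ ≤ B5Ineq137Torus.T P 0 x₁ w) →
          (∀ w, w ∉ (cubeT hPd (P.L ^ k) c' fun i => P.L ^ k * M' i) → ρ ≤ B5Ineq137Torus.T P 0 x₂ w) →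
        ∀ (g : Balaban1983to89.Site P 0 → ℂ) (F D Db Df : ℝ), (∀ y, ‖g y‖ ≤ F) →
          (∀ y, y ∉ (cubeT hPd (P.L ^ k) c' fun i => P.L ^ k * M' i) → g y = 0) →
          0 ≤ D → (∀ y, g y ≠ 0 → D ≤ B5Ineq137Torus.T P 0 x₁ y) → (∀ y, g y ≠ 0 → D ≤ B5Ineq137Torus.T P 0 x₂ y) →
          0 ≤ Db → (∀ w, w ∉ (cubeT hPd (P.L ^ k) c' fun i => P.L ^ k * M' i) → Db ≤ B5Ineq137Torus.T P 0 x₁ w) →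
          (∀ w, w ∉ (cubeT hPd (P.L ^ k) c' fun i => P.L ^ k * M' i) → Db ≤ B5Ineq137Torus.T P 0 x₂ w) →
          0 ≤ Df → (∀ y, g y ≠ 0 → ∀ w, w ∉ (cubeT hPd (P.L ^ k) c' fun i => P.L ^ k * M' i) → Df ≤ B5Ineq137Torus.T P 0 y w) →
          ((P.L : ℝ) ^ k / B5Ineq137Torus.T P 0 x₁ x₂) ^ θ *
              ‖stairHol U x₁ x₂ *
                  covD P.eps⁻¹ (cfg U) (gBox (B1RG242Torus.α P a k * (P.L : ℝ) ^ (k * P.d)) P.eps⁻¹ U k (cubeT hPd (P.L ^ k) c' fun i => P.L ^ k * M' i) *ᵥ g -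
                    gBox (B1RG242Torus.α P a k * (P.L : ℝ) ^ (k * P.d)) P.eps⁻¹ U k Ω *ᵥ g) ⟨x₂, μ⟩ -
                covD P.eps⁻¹ (cfg U) (gBox (B1RG242Torus.α P a k * (P.L : ℝ) ^ (k * P.d)) P.eps⁻¹ U k (cubeT hPd (P.L ^ k) c' fun i => P.L ^ k * M' i) *ᵥ g -
                    gBox (B1RG242Torus.α P a k * (P.L : ℝ) ^ (k * P.d)) P.eps⁻¹ U k Ω *ᵥ g) ⟨x₁, μ⟩‖ ≤
            P.spacing k * (c₀ * Real.exp (-(δ₀ * (((P.L : ℝ) ^ k)⁻¹ * D))) * Real.exp (-(δ₀ * (((P.L : ℝ) ^ k)⁻¹ * (Db + Df)))) * F)) →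
      -- (H6) the (1.9) Hölder-of-`D_u` member of `G_k(Ω,u)` at pairs of distinct `ρ`-deep rows of `Ω`
      (∀ (x₁ x₂ : Balaban1983to89.Site P 0) (μ : Fin P.d), x₁ ≠ x₂ → x₁ ∈ Ω → x₂ ∈ Ω →
          (∀ w, w ∉ Ω → ρ ≤ B5Ineq137Torus.T P 0 x₁ w) → (∀ w, w ∉ Ω → ρ ≤ B5Ineq137Torus.T P 0 x₂ w) →
        ∀ (g : Balaban1983to89.Site P 0 → ℂ) (F D : ℝ), (∀ y, ‖g y‖ ≤ F) → 0 ≤ D →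
          (∀ y, g y ≠ 0 → D ≤ B5Ineq137Torus.T P 0 x₁ y) → (∀ y, g y ≠ 0 → D ≤ B5Ineq137Torus.T P 0 x₂ y) →
          ((P.L : ℝ) ^ k / B5Ineq137Torus.T P 0 x₁ x₂) ^ θ *
              ‖stairHol U x₁ x₂ * covD P.eps⁻¹ (cfg U) (gBox (B1RG242Torus.α P a k * (P.L : ℝ) ^ (k * P.d)) P.eps⁻¹ U k Ω *ᵥ g) ⟨x₂, μ⟩ -
                covD P.eps⁻¹ (cfg U) (gBox (B1RG242Torus.α P a k * (P.L : ℝ) ^ (k * P.d)) P.eps⁻¹ U k Ω *ᵥ g) ⟨x₁, μ⟩‖ ≤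
            P.spacing k * (c₀ * Real.exp (-(δ₀ * (((P.L : ℝ) ^ k)⁻¹ * D))) * F)) →
      ∀ (c M0 : Fin (d + 1) → ℕ), (∀ i, 1 ≤ M0 i) →
        (∀ i, c i * P.L ^ k + P.L ^ k * M0 i ≤ P.sitesPerDir 0) → (∀ i, P.L ^ k * M0 i < P.sitesPerDir 0) →
        (cubeT hPd (P.L ^ k) c fun i => P.L ^ k * M0 i) ⊆ Ω →
      ∀ (s W : ℕ), 1 ≤ s → ∀ (R R₀ R₁ : ℝ), ρ + (P.L : ℝ) ^ k + 3 ≤ R → 1 ≤ R₁ → R₁ < R₀ → R₀ ≤ ((P.sitesPerDir 0 : ℝ) - 3) / 2 →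
        2 * (s : ℝ) / 3 + R₀ / 2 + R ≤ W → (∀ i, ((P.L ^ k * M0 i : ℕ) : ℝ) + R ≤ P.sitesPerDir 0) →
      ∀ (x₁ x₂ : Balaban1983to89.Site P 0) (μ : Fin P.d),
        x₁ ∈ (cubeT hPd (P.L ^ k) c fun i => P.L ^ k * M0 i) →
        (∀ i, R₀ + R ≤ (boxCoord hPd (P.L ^ k) c x₁ i : ℝ) ∧ (boxCoord hPd (P.L ^ k) c x₁ i : ℝ) + (R₀ + R) ≤ (P.L ^ k * M0 i : ℕ) - 1) →
        x₁.shift μ ∈ (cubeT hPd (P.L ^ k) c fun i => P.L ^ k * M0 i) →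
        (∀ i, R₀ + R ≤ (boxCoord hPd (P.L ^ k) c (x₁.shift μ) i : ℝ) ∧
          (boxCoord hPd (P.L ^ k) c (x₁.shift μ) i : ℝ) + (R₀ + R) ≤ (P.L ^ k * M0 i : ℕ) - 1) →
        x₂ ∈ (cubeT hPd (P.L ^ k) c fun i => P.L ^ k * M0 i) →
        (∀ i, R₀ + R ≤ (boxCoord hPd (P.L ^ k) c x₂ i : ℝ) ∧ (boxCoord hPd (P.L ^ k) c x₂ i : ℝ) + (R₀ + R) ≤ (P.L ^ k * M0 i : ℕ) - 1) →
        x₂.shift μ ∈ (cubeT hPd (P.L ^ k) c fun i => P.L ^ k * M0 i) →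
        (∀ i, R₀ + R ≤ (boxCoord hPd (P.L ^ k) c (x₂.shift μ) i : ℝ) ∧
          (boxCoord hPd (P.L ^ k) c (x₂.shift μ) i : ℝ) + (R₀ + R) ≤ (P.L ^ k * M0 i : ℕ) - 1) →
      ∀ (f : Balaban1983to89.Site P 0 → ℂ) (F D : ℝ), (∀ y, ‖f y‖ ≤ F) → 0 ≤ D →
        (∀ y, f y ≠ 0 → D ≤ B5Ineq137Torus.T P 0 x₁ y) → (∀ y, f y ≠ 0 → D ≤ B5Ineq137Torus.T P 0 x₂ y) →
        ((P.L : ℝ) ^ k / B5Ineq137Torus.T P 0 x₁ x₂) ^ θ *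
          ‖stairHol U x₁ x₂ *
              (covD P.eps⁻¹ (cfg U)
                  (gLocT (B1RG242Torus.α P a k * (P.L : ℝ) ^ (k * P.d)) P.eps⁻¹ U k
                    (cubeFam hPd (P.L ^ k) c M0 s W) (lamFam hPd (P.L ^ k) c M0 s) (zetaPi R₁ R₀ 0) *ᵥ f) ⟨x₂, μ⟩ -
                covD P.eps⁻¹ (cfg U) (gBox (B1RG242Torus.α P a k * (P.L : ℝ) ^ (k * P.d)) P.eps⁻¹ U k Ω *ᵥ f) ⟨x₂, μ⟩) -
            (covD P.eps⁻¹ (cfg U)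
                (gLocT (B1RG242Torus.α P a k * (P.L : ℝ) ^ (k * P.d)) P.eps⁻¹ U k
                  (cubeFam hPd (P.L ^ k) c M0 s W) (lamFam hPd (P.L ^ k) c M0 s) (zetaPi R₁ R₀ 0) *ᵥ f) ⟨x₁, μ⟩ -
              covD P.eps⁻¹ (cfg U) (gBox (B1RG242Torus.α P a k * (P.L : ℝ) ^ (k * P.d)) P.eps⁻¹ U k Ω *ᵥ f) ⟨x₁, μ⟩)‖ ≤
          P.spacing k * (C * Real.exp (3 * δ₀) * (1 + (P.L : ℝ) ^ k * ((R₀ - R₁)⁻¹ + (s : ℝ)⁻¹)) ^ 2 *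
            ((⌊(((P.L : ℝ) ^ k) - 1 + R₀) / s⌋₊ + 3) ^ (d + 1) * Real.exp (-(δ₀ * (((P.L : ℝ) ^ k)⁻¹ * (2 * R - 1)))) +
              Real.exp (-(δ₀ / 2 * (((P.L : ℝ) ^ k)⁻¹ * (R₁ - 1))))) *
            Real.exp (-(δ₀ / 2 * (((P.L : ℝ) ^ k)⁻¹ * D))) * F) := by
  obtain ⟨Cσ, hCσ0, hCσ1, hCσ2⟩ := exists_abs_deriv_and_deriv_deriv_smoothTransition_le
  have hK₂ : 0 ≤ Cσ ^ 2 + Cσ := by positivity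
  obtain ⟨C, hC0, H⟩ := derivHolder231_region_of_inputs_of_smooth d hc₀ hθ0 hθ1 hCσ0 hK₂
  refine ⟨C, hC0, ?_⟩
  intro P hPd a k hk1 hkK U Ω δ₀ ρ hδ₀ hρ H1 H2 H3 H4 H5 H6 c M0 hM0 hfit0 hN0 hΩ s W hs R R₀ R₁ hR hR₁ hR10 hR₀N hW hgap
    x₁ x₂ μ hx₁ hdeep₁ hx₁e hdeep₁e hx₂ hdeep₂ hx₂e hdeep₂e f F D hF hD hsupp₁ hsupp₂
  have e : secondDiffConst Cσ R₁ R₀ = (Cσ ^ 2 + Cσ) / (R₀ - R₁) ^ 2 := by rw [secondDiffConst, div_pow, add_div]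
  exact H P hPd a k hk1 hkK U Ω δ₀ ρ hδ₀ hρ H1 H2 H3 H4 H5 H6 c M0 hM0 hfit0 hN0 hΩ s W hs R R₀ R₁ hR (zero_le_one.trans hR₁) hR10 hW hgap
    (zetaPi R₁ R₀ 0) (abs_zetaPi_zero_le_one R₁ R₀) (zetaPi_zero_eq_zero_of_le hR10) (zetaPi_zero_eq_one_of_le hR10)
    (abs_zetaPi_zero_shift_sub_le hCσ1 hR10) (fun x y κ ν => (abs_zetaPi_zero_secondDiff_le hCσ1 hCσ2 hR10 hR₁ hR₀N x y κ ν).trans_eq e)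
    x₁ x₂ μ hx₁ hdeep₁ hx₁e hdeep₁e hx₂ hdeep₂ hx₂e hdeep₂e f F D hF hD hsupp₁ hsupp₂

end ZetaPiMember

end

end Literature.MathematicalPhysics.QuantumFieldTheory.BalabanImbrieJaffe1984to88.BIJ88LocDerivHolder231RegionOfInputs
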